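import Literature.NumberTheory.Automorphic.TruncatedFormBound
import Literature.NumberTheory.Automorphic.SmallSpectrumFormBound
import Literature.NumberTheory.Automorphic.KernelCompactContinuous
import Literature.NumberTheory.Automorphic.PretraceDyadic
import Literature.NumberTheory.Automorphic.BallVector
import Literature.NumberTheory.Automorphic.ModularLatticeCount

/-!
# The operator inequality behind (12.5), and the proofs of (12.5) and of Theorem 12.1
(Iwaniec, *Spectral Methods of Automorphic Forms*, GSM 53, proofs of Theorem 7.4 (7.17) and of
(12.5): the tempered spectrum is bounded through the local Weyl law (Prop. 7.2) and a decreasing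
majorant `H` of `|h|`; Theorem 12.1; PDF pp. 71–76, 125–126)

This file completes the Eisenstein-free proof of the named facts
`Literature.NumberTheory.Automorphic.Iwaniec2002_eq_12_5` (`AutomorphicKernel.lean`, the pretrace
estimate (12.5)) and `Literature.NumberTheory.Automorphic.Iwaniec2002_thm_12_1`
(`HyperbolicLaplaceSpectrum.lean`, Selberg's hyperbolic lattice-point theorem), discharged below as
`Iwaniec2002_eq_12_5_holds` and `Iwaniec2002_thm_12_1_holds`
(the latter through `Iwaniec2002_thm_12_1_of_eq_12_5` of `ModularLatticeCount.lean`).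

**Part I — the operator inequality.** For a finite volume group `Γ` (matrices, `-1 ∈ Γ`,
fundamental domain `F`, cusp data), its small eigenbasis `{u_j}`, a continuous test kernel `k` with a
majorant `H` of `|h_k|` (antitone on `[0, ∞)`), `|s| ≤ 1`, and the tent operators
`T_m = T_{k_{δ_m}}` of `PretraceDyadic`/`TentKernel`:
**`s Re ⟨T_k f, f⟩ - Σ_{m ≤ M} c_m ‖T_m f‖² ≤ H(2^M) ‖f‖²` for every `f ⊥ {u_j}`**
(`pretrace_form_bound`), obtained from `SmallSpectrumFormBound.re_inner_le_of_symbol_le` applied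
to `N = s T_k - Σ c_m T_m²`:

1. (§1) the density lemma of `TruncatedFormBound` with the diagonal and cross terms as hypotheses
   (`re_inner_cuspQ_le_of_nice`);
2. (§2) the forms of `T_k` and `T_m²` on the cusp vectors of nice profiles through Plancherel:
   `Re ⟨N V[Ψ], V[Ψ]⟩ = ∫ (s h_k(-2πξ) - Σ c_m h_{δ_m}(-2πξ)²) |𝓕Ψ(ξ)|² dξ ≤ β ‖Ψ‖²` whenever the
   symbol is `≤ β` on `ℝ` (`re_symbolForm_le`), and the vanishing of the cross terms;
3. (§3) the hypotheses of `re_inner_le_of_symbol_le` for `N`: self-adjointness, commutation with the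
   `T_{k'}`, compactness of `N Λ` (`KernelCompactContinuous`, `TruncatedKernelCompact`), the cusp
   form bound, the symbol on eigenfunctions, and the symbol inequality `symbol_le` of
   `PretraceDyadic`.

**Part II — the proof of (12.5).** The book proves (12.5) from the spectral expansion (7.17) of the
automorphic kernel (cusp forms and Eisenstein series, Chapters 6–7) and the local Weyl law (7.10).
Here the continuous spectrum is never parametrised: the expansion on the orthogonal complement `Sᗮ`
of the small eigenfunctions is replaced by the operator inequality of Part I, applied to
`f = G - proj G` for the approximate identities `G = G_w^δ + c G_z^{δ'}` of `BallVector`: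

4. (§4) the projection `proj x = Σ_j ⟨e_j, x⟩ e_j` onto the small eigenfunctions and the identity
   `⟨y - proj y, T (x - proj x)⟩ = ⟨y, T x⟩ - Σ_j ⟨e_j, x⟩ h(t_j) ⟨y, e_j⟩`;
5. (§5) the uniform bounds: `‖T_m G_w^δ‖² ≤ 2π δ_m N(w)` (local Weyl input, `TentKernel`,
   `BallVector.norm_sq_kernelCLM_ballVec_le`), `‖T_m‖ ≤ 2π δ_m`, `|⟨e_j, G_w^δ⟩| ≤ 2 |u_j(w)|`;
6. (§6) `Σ_m c_m ‖T_m f‖² ≤ C₁ (H(0) + ∫ (t+1) H)` by the dyadic sum bound of `PretraceDyadic`,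
   and, letting `M → ∞` and polarising, `|⟨T_k a', b'⟩| ≤ C₁ (H(0) + ∫ (t+1) H)`;
7. (§7) the limits `δ, δ' → 0` (`BallVector`): `⟨b', T_k a'⟩ → ½ K(z, w) - Σ_j ū_j(w) h(t_j) u_j(z)`,
   the conclusion `Iwaniec2002_eq_12_5_holds` with `C = 2 C₁`, and `Iwaniec2002_thm_12_1_holds`.

Everything here is proved; nothing is vendored; no fact is introduced.

## References
* [Iwaniec2002] H. Iwaniec, *Spectral Methods of Automorphic Forms*, 2nd ed., GSM 53, AMS 2002,
  Prop. 7.2, Thms 7.3–7.4, (12.5)–(12.9), Thm 12.1, PDF pp. 71–76, 125–126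
  (held copy `book:iwaniec2002-spectral-methods-automorphic-forms`).
-/

noncomputable section

open MeasureTheory Set Filter Real UpperHalfPlane Convolution FourierTransform
open scoped Topology MatrixGroups ComplexConjugate NNReal ENNReal Pointwise InnerProductSpace InnerProduct

namespace Literature.NumberTheory.Automorphic

variable {Γ : Subgroup (GL (Fin 2) ℝ)} {F : Set ℍ}

/-! ## 2a. The symbol form through Plancherel -/

section SymbolForm

/-- For a real test kernel the Fourier transform of its profile is real: `𝓕g(ξ) = Re h(-2πξ)`. [folklore] -/
theorem fourier_selbergG_eq_re (k : ℝ → ℝ) (ξ : ℝ) :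
    𝓕 (fun r => ((selbergG k r : ℝ) : ℂ)) ξ = ((selbergTransform k ((-(2 * π * ξ) : ℝ) : ℂ)).re : ℂ) := by
  rw [Fuchsian.fourier_selbergG_eq, ← selbergTransform_ofReal_eq_re]

/-- **The symbol form.** For test kernels `k`, `k_m`, real `s`, `c_m`, `β` with
`s Re h_k(t) - Σ_m c_m (Re h_{k_m}(t))² ≤ β` for all real `t`, and `Ψ ∈ L¹ ∩ L²(ℝ)` with all
`g ⋆ Ψ ∈ L¹ ∩ L²`: `Re [s ∫ conj(g_k ⋆ Ψ) Ψ - Σ_m c_m ∫ |g_{k_m} ⋆ Ψ|²] ≤ β ∫ |Ψ|²`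
(Plancherel: the left side is `∫ (s 𝓕g_k - Σ c_m |𝓕g_{k_m}|²) |𝓕Ψ|²`, and `𝓕g(ξ) = h(-2πξ)`).
[cite: Iwaniec2002, §4.2 (4.12) & §7.1 Prop. 7.1, PDF pp. 51, 69–71] -/
theorem re_symbolForm_le {k : ℝ → ℝ} {km : ℕ → ℝ → ℝ} (hk : IsTestKernel k) (hkm : ∀ m, IsTestKernel (km m))
    {s : ℝ} {c : ℕ → ℝ} {A : Finset ℕ} {β : ℝ}
    (hβ : ∀ t : ℝ, s * (selbergTransform k t).re - ∑ m ∈ A, c m * (selbergTransform (km m) t).re ^ 2 ≤ β)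
    {Ψ : ℝ → ℂ} (hΨ1 : Integrable Ψ) (hΨ2 : MemLp Ψ 2)
    (hC1 : Integrable ((fun r => ((selbergG k r : ℝ) : ℂ)) ⋆[ContinuousLinearMap.mul ℂ ℂ] Ψ))
    (hC2 : MemLp ((fun r => ((selbergG k r : ℝ) : ℂ)) ⋆[ContinuousLinearMap.mul ℂ ℂ] Ψ) 2)
    (hCm1 : ∀ m, Integrable ((fun r => ((selbergG (km m) r : ℝ) : ℂ)) ⋆[ContinuousLinearMap.mul ℂ ℂ] Ψ))
    (hCm2 : ∀ m, MemLp ((fun r => ((selbergG (km m) r : ℝ) : ℂ)) ⋆[ContinuousLinearMap.mul ℂ ℂ] Ψ) 2) :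
    ((s : ℂ) * (∫ v, conj (((fun r => ((selbergG k r : ℝ) : ℂ)) ⋆[ContinuousLinearMap.mul ℂ ℂ] Ψ) v) * Ψ v) -
      ∑ m ∈ A, (c m : ℂ) * ∫ v, conj (((fun r => ((selbergG (km m) r : ℝ) : ℂ)) ⋆[ContinuousLinearMap.mul ℂ ℂ] Ψ) v) *
        ((fun r => ((selbergG (km m) r : ℝ) : ℂ)) ⋆[ContinuousLinearMap.mul ℂ ℂ] Ψ) v).re ≤
      β * ∫ v, ‖Ψ v‖ ^ 2 := by
  set G : ℝ → ℂ := fun r => ((selbergG k r : ℝ) : ℂ) with hG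
  set Gm : ℕ → ℝ → ℂ := fun m r => ((selbergG (km m) r : ℝ) : ℂ) with hGm
  have hGi : Integrable G := Fuchsian.integrable_selbergG_ofReal hk
  have hGmi : ∀ m, Integrable (Gm m) := fun m => Fuchsian.integrable_selbergG_ofReal (hkm m)
  change ((s : ℂ) * (∫ v, conj ((G ⋆[ContinuousLinearMap.mul ℂ ℂ] Ψ) v) * Ψ v) -
      ∑ m ∈ A, (c m : ℂ) * ∫ v, conj ((Gm m ⋆[ContinuousLinearMap.mul ℂ ℂ] Ψ) v) * (Gm m ⋆[ContinuousLinearMap.mul ℂ ℂ] Ψ) v).re ≤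
    β * ∫ v, ‖Ψ v‖ ^ 2
  -- the weight `w = |𝓕Ψ|²`
  set w : ℝ → ℝ := fun ξ => ‖𝓕 Ψ ξ‖ ^ 2 with hw
  have hFΨ : MemLp (𝓕 Ψ) 2 (volume : Measure ℝ) := Literature.Analysis.FunctionSpaces.memLp_two_fourierIntegral hΨ1 hΨ2
  have hwi : Integrable w (volume : Measure ℝ) := (memLp_two_iff_integrable_sq_norm hFΨ.1).1 hFΨ
  have hw0 : ∀ ξ, 0 ≤ w ξ := fun ξ => sq_nonneg _
  have hwΨ : ∫ ξ, w ξ = ∫ v, ‖Ψ v‖ ^ 2 := Literature.Analysis.FunctionSpaces.integral_norm_sq_fourierIntegral_eq hΨ1 hΨ2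
  -- symbols
  set σ₀ : ℝ → ℝ := fun ξ => (selbergTransform k ((-(2 * π * ξ) : ℝ) : ℂ)).re with hσ₀
  set σm : ℕ → ℝ → ℝ := fun m ξ => (selbergTransform (km m) ((-(2 * π * ξ) : ℝ) : ℂ)).re with hσm
  have hFG : ∀ ξ, 𝓕 G ξ = (σ₀ ξ : ℂ) := fun ξ => fourier_selbergG_eq_re k ξ
  have hFGm : ∀ m ξ, 𝓕 (Gm m) ξ = (σm m ξ : ℂ) := fun m ξ => fourier_selbergG_eq_re (km m) ξ
  -- the symbols are bounded (by the `L¹` norms)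
  have hσ₀b : ∀ ξ, |σ₀ ξ| ≤ ∫ x, ‖G x‖ := fun ξ => by
    have := Literature.Analysis.FunctionSpaces.norm_fourierIntegral_le_integral_norm (G := G) ξ
    rwa [hFG, Complex.norm_real, Real.norm_eq_abs] at this
  have hσmb : ∀ m ξ, |σm m ξ| ≤ ∫ x, ‖Gm m x‖ := fun m ξ => by
    have := Literature.Analysis.FunctionSpaces.norm_fourierIntegral_le_integral_norm (G := Gm m) ξ
    rwa [hFGm, Complex.norm_real, Real.norm_eq_abs] at this
  have hσ₀m : Measurable σ₀ := by
    have : Continuous (𝓕 G) := Literature.Analysis.FunctionSpaces.continuous_fourierIntegral hGi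
    have e : σ₀ = fun ξ => (𝓕 G ξ).re := funext fun ξ => by rw [hFG, Complex.ofReal_re]
    rw [e]
    exact (Complex.continuous_re.comp this).measurable
  have hσmm : ∀ m, Measurable (σm m) := by
    intro m
    have : Continuous (𝓕 (Gm m)) := Literature.Analysis.FunctionSpaces.continuous_fourierIntegral (hGmi m)
    have e : σm m = fun ξ => (𝓕 (Gm m) ξ).re := funext fun ξ => by rw [hFGm, Complex.ofReal_re]
    rw [e]
    exact (Complex.continuous_re.comp this).measurable
  -- the first term: `∫ conj(G ⋆ Ψ) Ψ = conj ∫ 𝓕G w = ∫ σ₀ w`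
  have hP1 : ∫ v, conj ((G ⋆[ContinuousLinearMap.mul ℂ ℂ] Ψ) v) * Ψ v = ((∫ ξ, σ₀ ξ * w ξ : ℝ) : ℂ) := by
    have e1 : ∫ v, conj ((G ⋆[ContinuousLinearMap.mul ℂ ℂ] Ψ) v) * Ψ v =
        conj (∫ v, conj (Ψ v) * (G ⋆[ContinuousLinearMap.mul ℂ ℂ] Ψ) v) := by
      rw [← integral_conj]
      refine integral_congr_ae (Eventually.of_forall fun v => ?_)
      simp only [map_mul, Complex.conj_conj]
      ring
    rw [e1, Literature.Analysis.FunctionSpaces.integral_conj_mul_eq_integral_conj_fourier_mul hΨ1 hΨ2 hC1 hC2]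
    have hpt : ∀ ξ, conj (𝓕 Ψ ξ) * 𝓕 (G ⋆[ContinuousLinearMap.mul ℂ ℂ] Ψ) ξ = ((σ₀ ξ * ‖𝓕 Ψ ξ‖ ^ 2 : ℝ) : ℂ) := by
      intro ξ
      rw [Real.fourier_mul_convolution_eq hGi hΨ1 ξ, hFG, Complex.ofReal_mul, Complex.ofReal_pow, ← Complex.conj_mul' (𝓕 Ψ ξ)]
      ring
    simp_rw [hpt]
    rw [integral_complex_ofReal, Complex.conj_ofReal]
  -- the square terms: `∫ |G_m ⋆ Ψ|² = ∫ σm² w`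
  have hP2 : ∀ m, ∫ v, conj ((Gm m ⋆[ContinuousLinearMap.mul ℂ ℂ] Ψ) v) * (Gm m ⋆[ContinuousLinearMap.mul ℂ ℂ] Ψ) v =
      ((∫ ξ, σm m ξ ^ 2 * w ξ : ℝ) : ℂ) := by
    intro m
    have hCm1' : Integrable (Gm m ⋆[ContinuousLinearMap.mul ℂ ℂ] Ψ) := hCm1 m
    have hCm2' : MemLp (Gm m ⋆[ContinuousLinearMap.mul ℂ ℂ] Ψ) 2 (volume : Measure ℝ) := hCm2 m
    rw [Literature.Analysis.FunctionSpaces.integral_conj_mul_eq_integral_conj_fourier_mul hCm1' hCm2' hCm1' hCm2']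
    have hpt : ∀ ξ, conj (𝓕 (Gm m ⋆[ContinuousLinearMap.mul ℂ ℂ] Ψ) ξ) * 𝓕 (Gm m ⋆[ContinuousLinearMap.mul ℂ ℂ] Ψ) ξ =
        ((σm m ξ ^ 2 * ‖𝓕 Ψ ξ‖ ^ 2 : ℝ) : ℂ) := by
      intro ξ
      rw [Real.fourier_mul_convolution_eq (hGmi m) hΨ1 ξ, hFGm, Complex.conj_mul', norm_mul, Complex.norm_real,
        Real.norm_eq_abs, ← Complex.ofReal_pow, mul_pow, sq_abs]
    simp_rw [hpt]
    rw [integral_complex_ofReal]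
  -- integrability of the weighted symbols
  have hI0 : Integrable (fun ξ => σ₀ ξ * w ξ) (volume : Measure ℝ) := by
    refine Integrable.bdd_mul (c := ∫ x, ‖G x‖) hwi hσ₀m.aestronglyMeasurable (Eventually.of_forall fun ξ => ?_)
    rw [Real.norm_eq_abs]; exact hσ₀b ξ
  have hIm : ∀ m, Integrable (fun ξ => σm m ξ ^ 2 * w ξ) (volume : Measure ℝ) := by
    intro m
    refine Integrable.bdd_mul (c := (∫ x, ‖Gm m x‖) ^ 2) hwi ((hσmm m).pow_const 2).aestronglyMeasurable
      (Eventually.of_forall fun ξ => ?_)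
    rw [Real.norm_eq_abs, abs_pow]
    exact pow_le_pow_left₀ (abs_nonneg _) (hσmb m ξ) 2
  -- assemble the real part
  have hre : ((s : ℂ) * (∫ v, conj ((G ⋆[ContinuousLinearMap.mul ℂ ℂ] Ψ) v) * Ψ v) -
      ∑ m ∈ A, (c m : ℂ) * ∫ v, conj ((Gm m ⋆[ContinuousLinearMap.mul ℂ ℂ] Ψ) v) * (Gm m ⋆[ContinuousLinearMap.mul ℂ ℂ] Ψ) v).re =
      ∫ ξ, (s * σ₀ ξ - ∑ m ∈ A, c m * σm m ξ ^ 2) * w ξ := by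
    rw [hP1]
    simp_rw [hP2]
    have e1 : ((s : ℂ) * ((∫ ξ, σ₀ ξ * w ξ : ℝ) : ℂ) - ∑ m ∈ A, (c m : ℂ) * ((∫ ξ, σm m ξ ^ 2 * w ξ : ℝ) : ℂ)).re =
        s * (∫ ξ, σ₀ ξ * w ξ) - ∑ m ∈ A, c m * ∫ ξ, σm m ξ ^ 2 * w ξ := by
      have : ((s : ℂ) * ((∫ ξ, σ₀ ξ * w ξ : ℝ) : ℂ) - ∑ m ∈ A, (c m : ℂ) * ((∫ ξ, σm m ξ ^ 2 * w ξ : ℝ) : ℂ)) =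
          ((s * (∫ ξ, σ₀ ξ * w ξ) - ∑ m ∈ A, c m * ∫ ξ, σm m ξ ^ 2 * w ξ : ℝ) : ℂ) := by push_cast; ring
      rw [this, Complex.ofReal_re]
    rw [e1, ← integral_const_mul]
    have e2 : ∑ m ∈ A, c m * ∫ ξ, σm m ξ ^ 2 * w ξ = ∫ ξ, ∑ m ∈ A, c m * (σm m ξ ^ 2 * w ξ) := by
      rw [integral_finsetSum _ fun m _ => (hIm m).const_mul (c m)]
      refine Finset.sum_congr rfl fun m _ => ?_
      rw [integral_const_mul]
    rw [e2, ← integral_sub (hI0.const_mul s) (integrable_finsetSum _ fun m _ => (hIm m).const_mul (c m))]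
    refine integral_congr_ae (Eventually.of_forall fun ξ => ?_)
    simp only
    rw [sub_mul, Finset.sum_mul]
    congr 1
    · ring
    · exact Finset.sum_congr rfl fun m _ => by ring
  rw [hre, ← hwΨ, ← integral_const_mul]
  refine integral_mono ?_ (hwi.const_mul β) fun ξ => ?_
  · have : Integrable (fun ξ => s * (σ₀ ξ * w ξ) - ∑ m ∈ A, c m * (σm m ξ ^ 2 * w ξ)) (volume : Measure ℝ) :=
      (hI0.const_mul s).sub (integrable_finsetSum _ fun m _ => (hIm m).const_mul (c m))
    refine this.congr (Eventually.of_forall fun ξ => ?_)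
    simp only
    rw [sub_mul, Finset.sum_mul]
    congr 1
    · ring
    · exact Finset.sum_congr rfl fun m _ => by ring
  · exact mul_le_mul_of_nonneg_right (hβ _) (hw0 ξ)

end SymbolForm

namespace Fuchsian

variable {h : ℕ} {𝔞 : Fin h → OnePoint ℝ} {σ : Fin h → SL(2, ℝ)}

set_option quotPrecheck false in
/-- `L²(F)`. -/
local notation "L2F" => Lp ℂ 2 ((volume : Measure ℍ).restrict F)

/-! ## 1. The density lemma with the diagonal and cross terms as hypotheses -/

section Density

variable (hΓ : Γ ≤ (Matrix.SpecialLinearGroup.toGL : SL(2, ℝ) →* GL (Fin 2) ℝ).range)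
  (hneg : (-1 : GL (Fin 2) ℝ) ∈ Γ) (hd : IsDiscreteSubgroup Γ) (hF : IsHypFundamentalDomain Γ F)
  (hinfty : ∀ i, (Matrix.SpecialLinearGroup.toGL (σ i) : GL (Fin 2) ℝ) • (OnePoint.infty : OnePoint ℝ) = 𝔞 i)
  (hper : ∀ i, (ConjAct.toConjAct (Matrix.SpecialLinearGroup.toGL (σ i) : GL (Fin 2) ℝ)⁻¹ • Γ).strictPeriods =
    AddSubgroup.zmultiples 1)
  (hineq : ∀ i j, ∀ γ ∈ Γ, γ • 𝔞 i = 𝔞 j → i = j)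

include hΓ hneg hd hF hinfty hper hineq in
/-- **`Re ⟨N Q f, Q f⟩ ≤ β ‖Q f‖²`** as soon as, on the cusp vectors of nice profiles, the diagonal
forms are `≤ β ‖Ψ‖²` and the cross terms of distinct cusps vanish (nice profiles are dense).
[cite: Iwaniec2002, §4.2 (4.12) & §7.1 Prop. 7.1, PDF pp. 51, 69–71] -/
theorem re_inner_cuspQ_le_of_nice {N : L2F →L[ℂ] L2F} {Y : ℝ} (hY : 1 ≤ Y) {β : ℝ}
    (hdiag : ∀ (i : Fin h) (b : ℝ) (Ψ : ℝ → ℂ) (hΨ : IsNiceProfile Y b Ψ),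
      (⟪N (cuspV hΓ hneg hd hF hper hY i (hΨ.memLp.toLp Ψ)), cuspV hΓ hneg hd hF hper hY i (hΨ.memLp.toLp Ψ)⟫_ℂ).re ≤
        β * ‖hΨ.memLp.toLp Ψ‖ ^ 2)
    (hcross : ∀ (i j : Fin h), i ≠ j → ∀ (b b' : ℝ) (Ψ Ψ' : ℝ → ℂ) (hΨ : IsNiceProfile Y b Ψ) (hΨ' : IsNiceProfile Y b' Ψ'),
      ⟪N (cuspV hΓ hneg hd hF hper hY i (hΨ.memLp.toLp Ψ)), cuspV hΓ hneg hd hF hper hY j (hΨ'.memLp.toLp Ψ')⟫_ℂ = 0)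
    (f : L2F) :
    (⟪N (cuspQ hΓ hneg hd hF hper hY f), cuspQ hΓ hneg hd hF hper hY f⟫_ℂ).re ≤ β * ‖cuspQ hΓ hneg hd hF hper hY f‖ ^ 2 := by
  set V := fun i => cuspV hΓ hneg hd hF hper hY i with hV
  have hmeas : ∀ g : Lp ℂ 2 ((volume : Measure ℝ).restrict (Ioi (Real.log Y))), Measurable (g : ℝ → ℂ) :=
    fun g => (Lp.stronglyMeasurable g).measurable
  -- (i) the diagonal terms for arbitrary classes
  have hdiag' : ∀ (i : Fin h) (g : Lp ℂ 2 ((volume : Measure ℝ).restrict (Ioi (Real.log Y)))),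
      (⟪N (V i g), V i g⟫_ℂ).re ≤ β * ‖g‖ ^ 2 := by
    intro i g
    have hlim := tendsto_toLp_niceTrunc (Y := Y) g
    have h1 : Tendsto (fun n : ℕ => (⟪N (V i ((isNiceProfile_niceTrunc Y (hmeas g) n).memLp.toLp (niceTrunc Y g n))),
        V i ((isNiceProfile_niceTrunc Y (hmeas g) n).memLp.toLp (niceTrunc Y g n))⟫_ℂ).re) atTop
        (𝓝 ((⟪N (V i g), V i g⟫_ℂ).re)) := by
      have hc : Continuous fun g' : Lp ℂ 2 ((volume : Measure ℝ).restrict (Ioi (Real.log Y))) =>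
          (⟪N (V i g'), V i g'⟫_ℂ).re :=
        Complex.continuous_re.comp (Continuous.inner ((N.continuous.comp (V i).continuous)) (V i).continuous)
      exact (hc.tendsto g).comp hlim
    have h2 : Tendsto (fun n : ℕ => β * ‖(isNiceProfile_niceTrunc Y (hmeas g) n).memLp.toLp (niceTrunc Y g n)‖ ^ 2)
        atTop (𝓝 (β * ‖g‖ ^ 2)) :=
      ((continuous_const.mul (continuous_norm.pow 2)).tendsto g).comp hlim
    exact le_of_tendsto_of_tendsto' h1 h2 fun n => hdiag i _ _ (isNiceProfile_niceTrunc Y (hmeas g) n)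
  -- (ii) the cross terms for arbitrary classes
  have hcross' : ∀ (i j : Fin h), i ≠ j → ∀ (g g' : Lp ℂ 2 ((volume : Measure ℝ).restrict (Ioi (Real.log Y)))),
      ⟪N (V i g), V j g'⟫_ℂ = 0 := by
    intro i j hij g g'
    have hstep : ∀ (n : ℕ), ⟪N (V i g), V j ((isNiceProfile_niceTrunc Y (hmeas g') n).memLp.toLp (niceTrunc Y g' n))⟫_ℂ = 0 := by
      intro n
      have hlim := tendsto_toLp_niceTrunc (Y := Y) g
      have hc : Continuous fun g₀ : Lp ℂ 2 ((volume : Measure ℝ).restrict (Ioi (Real.log Y))) =>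
          ⟪N (V i g₀), V j ((isNiceProfile_niceTrunc Y (hmeas g') n).memLp.toLp (niceTrunc Y g' n))⟫_ℂ :=
        Continuous.inner (N.continuous.comp (V i).continuous) continuous_const
      have h0 : Tendsto ((fun g₀ : Lp ℂ 2 ((volume : Measure ℝ).restrict (Ioi (Real.log Y))) =>
          ⟪N (V i g₀), V j ((isNiceProfile_niceTrunc Y (hmeas g') n).memLp.toLp (niceTrunc Y g' n))⟫_ℂ) ∘
          (fun m : ℕ => (isNiceProfile_niceTrunc Y (hmeas g) m).memLp.toLp (niceTrunc Y g m))) atTop (𝓝 0) := by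
        have : ((fun g₀ : Lp ℂ 2 ((volume : Measure ℝ).restrict (Ioi (Real.log Y))) =>
            ⟪N (V i g₀), V j ((isNiceProfile_niceTrunc Y (hmeas g') n).memLp.toLp (niceTrunc Y g' n))⟫_ℂ) ∘
            (fun m : ℕ => (isNiceProfile_niceTrunc Y (hmeas g) m).memLp.toLp (niceTrunc Y g m))) = fun _ => 0 := by
          funext m
          simp only [Function.comp_apply]
          exact hcross i j hij _ _ _ _ (isNiceProfile_niceTrunc Y (hmeas g) m) (isNiceProfile_niceTrunc Y (hmeas g') n)
        rw [this]
        exact tendsto_const_nhds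
      exact tendsto_nhds_unique ((hc.tendsto g).comp hlim) h0
    have hlim := tendsto_toLp_niceTrunc (Y := Y) g'
    have hc : Continuous fun g₀ : Lp ℂ 2 ((volume : Measure ℝ).restrict (Ioi (Real.log Y))) => ⟪N (V i g), V j g₀⟫_ℂ :=
      Continuous.inner continuous_const (V j).continuous
    have h0 : Tendsto ((fun g₀ : Lp ℂ 2 ((volume : Measure ℝ).restrict (Ioi (Real.log Y))) => ⟪N (V i g), V j g₀⟫_ℂ) ∘
        (fun n : ℕ => (isNiceProfile_niceTrunc Y (hmeas g') n).memLp.toLp (niceTrunc Y g' n))) atTop (𝓝 0) := by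
      have : ((fun g₀ : Lp ℂ 2 ((volume : Measure ℝ).restrict (Ioi (Real.log Y))) => ⟪N (V i g), V j g₀⟫_ℂ) ∘
          (fun n : ℕ => (isNiceProfile_niceTrunc Y (hmeas g') n).memLp.toLp (niceTrunc Y g' n))) = fun _ => 0 :=
        funext fun n => hstep n
      rw [this]
      exact tendsto_const_nhds
    exact tendsto_nhds_unique ((hc.tendsto g').comp hlim) h0
  -- expand `Q f = Σ_i V_i (V_i† f)`
  set g : Fin h → Lp ℂ 2 ((volume : Measure ℝ).restrict (Ioi (Real.log Y))) := fun i => ContinuousLinearMap.adjoint (V i) f with hg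
  have hQ : cuspQ hΓ hneg hd hF hper hY f = ∑ i, V i (g i) := by
    rw [cuspQ_apply]
  rw [hQ, map_sum, sum_inner, Complex.re_sum]
  have hterm : ∀ i, (⟪N (V i (g i)), ∑ j, V j (g j)⟫_ℂ).re ≤ β * ‖g i‖ ^ 2 := by
    intro i
    rw [inner_sum, Complex.re_sum, Finset.sum_eq_single i (fun j _ hji => ?_) (fun h' => absurd (Finset.mem_univ i) h')]
    · exact hdiag' i (g i)
    · rw [hcross' i j (Ne.symm hji), Complex.zero_re]
  refine (Finset.sum_le_sum fun i _ => hterm i).trans (le_of_eq ?_)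
  rw [← Finset.mul_sum, ← hQ, norm_sq_cuspQ_apply hΓ hneg hd hF hinfty hper hineq hY f]

end Density

/-! ## 2b. The forms of `T_k` and `T_m²` on the cusp vectors of nice profiles -/

section NiceForms

variable (hΓ : Γ ≤ (Matrix.SpecialLinearGroup.toGL : SL(2, ℝ) →* GL (Fin 2) ℝ).range)
  (hneg : (-1 : GL (Fin 2) ℝ) ∈ Γ) (hd : IsDiscreteSubgroup Γ) (hF : IsHypFundamentalDomain Γ F)
  (hinfty : ∀ i, (Matrix.SpecialLinearGroup.toGL (σ i) : GL (Fin 2) ℝ) • (OnePoint.infty : OnePoint ℝ) = 𝔞 i)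
  (hper : ∀ i, (ConjAct.toConjAct (Matrix.SpecialLinearGroup.toGL (σ i) : GL (Fin 2) ℝ)⁻¹ • Γ).strictPeriods =
    AddSubgroup.zmultiples 1)
  (hineq : ∀ i j, ∀ γ ∈ Γ, γ • 𝔞 i = 𝔞 j → i = j)

include hΓ hneg hd hF hper in
/-- **The form of `T_k` on a cusp vector**: for a continuous test kernel `k` (`k = 0` on `[M, ∞)`),
levels `1 ≤ Y'`, `Y' e^R ≤ Y`, and a nice profile `Ψ` at level `Y`,
`⟨T_k V_i[Ψ], V_i[Ψ]⟩ = ∫ conj(g ⋆ Ψ) Ψ` with `g ⋆ Ψ ∈ L¹ ∩ L²`. [cite: Iwaniec2002, §4.2 (4.12), PDF p. 51] -/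
theorem inner_kernelCLM_cuspV_nice {k : ℝ → ℝ} (hk : IsTestKernel k) (hkc : Continuous k) {M : ℝ}
    (hM : ∀ u, M ≤ u → k u = 0) (hM0 : 0 ≤ M) {Y Y' : ℝ} (hY' : 1 ≤ Y')
    (hYY' : Y' * Real.exp (2 * Real.arsinh (Real.sqrt M)) ≤ Y) (hY : 1 ≤ Y)
    (i : Fin h) {b : ℝ} {Ψ : ℝ → ℂ} (hΨ : IsNiceProfile Y b Ψ) :
    ⟪kernelCLM hΓ hneg hd hF hk hkc (cuspV hΓ hneg hd hF hper hY i (hΨ.memLp.toLp Ψ)),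
        cuspV hΓ hneg hd hF hper hY i (hΨ.memLp.toLp Ψ)⟫_ℂ =
      ∫ v, conj (((fun r => ((selbergG k r : ℝ) : ℂ)) ⋆[ContinuousLinearMap.mul ℂ ℂ] Ψ) v) * Ψ v ∧
    Integrable ((fun r => ((selbergG k r : ℝ) : ℂ)) ⋆[ContinuousLinearMap.mul ℂ ℂ] Ψ) ∧
    MemLp ((fun r => ((selbergG k r : ℝ) : ℂ)) ⋆[ContinuousLinearMap.mul ℂ ℂ] Ψ) 2 (volume : Measure ℝ) := by
  have hR0 : 0 ≤ 2 * Real.arsinh (Real.sqrt M) :=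
    mul_nonneg zero_le_two (Real.arsinh_nonneg_iff.mpr (Real.sqrt_nonneg _))
  have hY'Y : Y' ≤ Y := le_trans (le_mul_of_one_le_right (by linarith) (Real.one_le_exp hR0)) hYY'
  obtain ⟨b', hΦ, hact⟩ := cuspAction_kernelCLM hΓ hneg hd hF hper hk hkc hM hM0 hY' hYY' i b Ψ hΨ
  obtain ⟨BC, hBC⟩ := hΦ.bounded
  obtain ⟨hC1, hC2⟩ := integrable_and_memLp_of_bounded_support hΦ.measurable hBC hΦ.eq_zero_of_le hΦ.eq_zero_of_ge
  refine ⟨?_, hC1, hC2⟩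
  have hact' : kernelCLM hΓ hneg hd hF hk hkc (cuspV hΓ hneg hd hF hper hY i (hΨ.memLp.toLp Ψ)) =
      cuspV hΓ hneg hd hF hper hY' i (hΦ.memLp.toLp _) := hact
  rw [hact', cuspV_toLp_eq_of_le hΓ hneg hd hF hper hY' hY'Y hΨ i, cuspV_apply, cuspV_apply,
    LinearIsometry.inner_map_map, inner_toLp_nice hΦ (hΨ.of_le (by linarith) hY'Y)]

include hΓ hneg hd hF hper in
/-- **The form of `T_k²` on a cusp vector**: with the same data,
`⟨T_k (T_k V_i[Ψ]), V_i[Ψ]⟩ = ∫ |g ⋆ Ψ|²`. [cite: Iwaniec2002, §4.2 (4.12), PDF p. 51] -/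
theorem inner_kernelCLM_sq_cuspV_nice {k : ℝ → ℝ} (hk : IsTestKernel k) (hkc : Continuous k) {M : ℝ}
    (hM : ∀ u, M ≤ u → k u = 0) (hM0 : 0 ≤ M) {Y Y' : ℝ} (hY' : 1 ≤ Y')
    (hYY' : Y' * Real.exp (2 * Real.arsinh (Real.sqrt M)) ≤ Y) (hY : 1 ≤ Y)
    (i : Fin h) {b : ℝ} {Ψ : ℝ → ℂ} (hΨ : IsNiceProfile Y b Ψ) :
    ⟪kernelCLM hΓ hneg hd hF hk hkc (kernelCLM hΓ hneg hd hF hk hkc (cuspV hΓ hneg hd hF hper hY i (hΨ.memLp.toLp Ψ))),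
        cuspV hΓ hneg hd hF hper hY i (hΨ.memLp.toLp Ψ)⟫_ℂ =
      ∫ v, conj (((fun r => ((selbergG k r : ℝ) : ℂ)) ⋆[ContinuousLinearMap.mul ℂ ℂ] Ψ) v) *
        ((fun r => ((selbergG k r : ℝ) : ℂ)) ⋆[ContinuousLinearMap.mul ℂ ℂ] Ψ) v := by
  obtain ⟨b', hΦ, hact⟩ := cuspAction_kernelCLM hΓ hneg hd hF hper hk hkc hM hM0 hY' hYY' i b Ψ hΨ
  have hact' : kernelCLM hΓ hneg hd hF hk hkc (cuspV hΓ hneg hd hF hper hY i (hΨ.memLp.toLp Ψ)) =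
      cuspV hΓ hneg hd hF hper hY' i (hΦ.memLp.toLp _) := hact
  have hsa := isSelfAdjoint_kernelCLM hΓ hneg hd hF hk hkc
  rw [← ContinuousLinearMap.adjoint_inner_right, hsa.adjoint_eq, hact', cuspV_apply, LinearIsometry.inner_map_map,
    inner_toLp_nice hΦ hΦ]

include hΓ hneg hd hF hinfty hper hineq in
/-- The cross terms of `T_k` vanish. [cite: Iwaniec2002, §2.2 (2.3)–(2.5) & §7.3, PDF pp. 30–31, 75] -/
theorem inner_kernelCLM_cuspV_cross {k : ℝ → ℝ} (hk : IsTestKernel k) (hkc : Continuous k) {M : ℝ}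
    (hM : ∀ u, M ≤ u → k u = 0) (hM0 : 0 ≤ M) {Y Y' : ℝ} (hY' : 1 ≤ Y')
    (hYY' : Y' * Real.exp (2 * Real.arsinh (Real.sqrt M)) ≤ Y) (hY : 1 ≤ Y)
    {i j : Fin h} (hij : i ≠ j) {b b' : ℝ} {Ψ Ψ' : ℝ → ℂ} (hΨ : IsNiceProfile Y b Ψ) (hΨ' : IsNiceProfile Y b' Ψ') :
    ⟪kernelCLM hΓ hneg hd hF hk hkc (cuspV hΓ hneg hd hF hper hY i (hΨ.memLp.toLp Ψ)),
      cuspV hΓ hneg hd hF hper hY j (hΨ'.memLp.toLp Ψ')⟫_ℂ = 0 := by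
  have hR0 : 0 ≤ 2 * Real.arsinh (Real.sqrt M) :=
    mul_nonneg zero_le_two (Real.arsinh_nonneg_iff.mpr (Real.sqrt_nonneg _))
  have hY'Y : Y' ≤ Y := le_trans (le_mul_of_one_le_right (by linarith) (Real.one_le_exp hR0)) hYY'
  obtain ⟨b'', hΦ, hact⟩ := cuspAction_kernelCLM hΓ hneg hd hF hper hk hkc hM hM0 hY' hYY' i b Ψ hΨ
  have hact' : kernelCLM hΓ hneg hd hF hk hkc (cuspV hΓ hneg hd hF hper hY i (hΨ.memLp.toLp Ψ)) =
      cuspV hΓ hneg hd hF hper hY' i (hΦ.memLp.toLp _) := hact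
  rw [hact', cuspV_toLp_eq_of_le hΓ hneg hd hF hper hY' hY'Y hΨ' j, cuspV_apply, cuspV_apply]
  exact inner_cuspIsometry_eq_zero_of_ne hΓ hneg hd hF hinfty hper hineq hij hY' _ _

include hΓ hneg hd hF hinfty hper hineq in
/-- The cross terms of `T_k²` vanish. [cite: Iwaniec2002, §2.2 (2.3)–(2.5) & §7.3, PDF pp. 30–31, 75] -/
theorem inner_kernelCLM_sq_cuspV_cross {k : ℝ → ℝ} (hk : IsTestKernel k) (hkc : Continuous k) {M : ℝ}
    (hM : ∀ u, M ≤ u → k u = 0) (hM0 : 0 ≤ M) {Y Y' : ℝ} (hY' : 1 ≤ Y')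
    (hYY' : Y' * Real.exp (2 * Real.arsinh (Real.sqrt M)) ≤ Y) (hY : 1 ≤ Y)
    {i j : Fin h} (hij : i ≠ j) {b b' : ℝ} {Ψ Ψ' : ℝ → ℂ} (hΨ : IsNiceProfile Y b Ψ) (hΨ' : IsNiceProfile Y b' Ψ') :
    ⟪kernelCLM hΓ hneg hd hF hk hkc (kernelCLM hΓ hneg hd hF hk hkc (cuspV hΓ hneg hd hF hper hY i (hΨ.memLp.toLp Ψ))),
      cuspV hΓ hneg hd hF hper hY j (hΨ'.memLp.toLp Ψ')⟫_ℂ = 0 := by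
  obtain ⟨b₁, hΦ, hact⟩ := cuspAction_kernelCLM hΓ hneg hd hF hper hk hkc hM hM0 hY' hYY' i b Ψ hΨ
  obtain ⟨b₂, hΦ', hact₂⟩ := cuspAction_kernelCLM hΓ hneg hd hF hper hk hkc hM hM0 hY' hYY' j b' Ψ' hΨ'
  have hact' : kernelCLM hΓ hneg hd hF hk hkc (cuspV hΓ hneg hd hF hper hY i (hΨ.memLp.toLp Ψ)) =
      cuspV hΓ hneg hd hF hper hY' i (hΦ.memLp.toLp _) := hact
  have hact₂' : kernelCLM hΓ hneg hd hF hk hkc (cuspV hΓ hneg hd hF hper hY j (hΨ'.memLp.toLp Ψ')) =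
      cuspV hΓ hneg hd hF hper hY' j (hΦ'.memLp.toLp _) := hact₂
  have hsa := isSelfAdjoint_kernelCLM hΓ hneg hd hF hk hkc
  rw [← ContinuousLinearMap.adjoint_inner_right, hsa.adjoint_eq, hact', hact₂', cuspV_apply, cuspV_apply]
  exact inner_cuspIsometry_eq_zero_of_ne hΓ hneg hd hF hinfty hper hineq hij hY' _ _

end NiceForms

/-! ## 3. The operator inequality -/

section Main

variable (hΓ : Γ ≤ (Matrix.SpecialLinearGroup.toGL : SL(2, ℝ) →* GL (Fin 2) ℝ).range)
  (hneg : (-1 : GL (Fin 2) ℝ) ∈ Γ) (hd : IsDiscreteSubgroup Γ) (hF : IsHypFundamentalDomain Γ F)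
  (hvol : volume F < ⊤)
  (hinfty : ∀ i, (Matrix.SpecialLinearGroup.toGL (σ i) : GL (Fin 2) ℝ) • (OnePoint.infty : OnePoint ℝ) = 𝔞 i)
  (hper : ∀ i, (ConjAct.toConjAct (Matrix.SpecialLinearGroup.toGL (σ i) : GL (Fin 2) ℝ)⁻¹ • Γ).strictPeriods =
    AddSubgroup.zmultiples 1)
  (hineq : ∀ i j, ∀ γ ∈ Γ, γ • 𝔞 i = 𝔞 j → i = j)
  (hcomplete : ∀ c : OnePoint ℝ, IsCusp c Γ → ∃ i, ∃ γ ∈ Γ, γ • 𝔞 i = c)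

/-- The tent operators `T_m = T_{k_{δ_m}}` of the dyadic pieces. [cite: Iwaniec2002, proof of Prop. 7.2, PDF p. 73] -/
def tentOp (m : ℕ) : L2F →L[ℂ] L2F :=
  kernelCLM hΓ hneg hd hF (isTestKernel_tentKernel (dyadicDelta_pos m)) (continuous_tentKernel (dyadicDelta_pos m))

/-- The radius `R_m = 2 arsinh √δ_m` of the tent kernel is at most `R_0`. [folklore] -/
theorem tentRadius_le (m : ℕ) :
    2 * Real.arsinh (Real.sqrt (dyadicDelta m)) ≤ 2 * Real.arsinh (Real.sqrt (dyadicDelta 0)) := by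
  have hle : dyadicDelta m ≤ dyadicDelta 0 := by
    unfold dyadicDelta
    rw [inv_le_inv₀ (by positivity) (by positivity)]
    have : (1 : ℝ) ≤ 2 ^ m := one_le_pow₀ (by norm_num)
    nlinarith
  exact mul_le_mul_of_nonneg_left (Real.arsinh_le_arsinh.mpr (Real.sqrt_le_sqrt hle)) zero_le_two

include hΓ hneg hd hF hvol hinfty hper hineq hcomplete in
/-- **The operator inequality behind (12.5).** For a continuous test kernel `k` with a majorant `H` of
`|h_k|` on `[0, ∞)`, antitone on `[0, ∞)`, for `|s| ≤ 1`, every `M` and every `f ∈ L²(F)` orthogonal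
to the small eigenfunctions:
`s Re ⟨T_k f, f⟩ - Σ_{m ≤ M} c_m ‖T_m f‖² ≤ H(2^M) ‖f‖²`, `c_m = H(a_m)/(π δ_m)²`.
(The tempered spectral expansion of `⟨T_k f, f⟩`, (7.17) on `Sᗮ`, majorised dyadically through the
tent operators whose transforms dominate the pieces of `H`.) [cite: Iwaniec2002, Prop. 7.2, Thm 7.4 (7.17) & proof of (12.5), PDF pp. 71–76, 126] -/
theorem pretrace_form_bound (B : SmallEigenbasis Γ F) {k : ℝ → ℝ} (hk : IsTestKernel k) (hkc : Continuous k)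
    {H : ℝ → ℝ} (hH : AntitoneOn H (Ici 0)) (hHh : ∀ t : ℝ, 0 ≤ t → ‖selbergTransform k t‖ ≤ H t)
    {s : ℝ} (hs : |s| ≤ 1) (M : ℕ) (f : L2F) (hf : ∀ j, ⟪B.vec j, f⟫_ℂ = 0) :
    s * (⟪kernelCLM hΓ hneg hd hF hk hkc f, f⟫_ℂ).re -
        ∑ m ∈ Finset.range (M + 1), dyadicCoeff H m * ‖tentOp hΓ hneg hd hF m f‖ ^ 2 ≤
      H (2 ^ M) * ‖f‖ ^ 2 := by
  classical
  obtain ⟨_, ⟨Bk, hBk⟩, ⟨Mk, hMk0, hMk⟩⟩ := id hk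
  -- tent data
  have htk : ∀ m, IsTestKernel (tentKernel (dyadicDelta m)) := fun m => isTestKernel_tentKernel (dyadicDelta_pos m)
  have htkc : ∀ m, Continuous (tentKernel (dyadicDelta m)) := fun m => continuous_tentKernel (dyadicDelta_pos m)
  have htL : ∀ m, LipschitzWith (Real.toNNReal (dyadicDelta m)⁻¹) (tentKernel (dyadicDelta m)) := fun m =>
    lipschitzWith_tentKernel (dyadicDelta_pos m)
  have htM : ∀ m, ∀ u, dyadicDelta m ≤ u → tentKernel (dyadicDelta m) u = 0 := fun m u hu =>
    tentKernel_eq_zero (dyadicDelta_pos m) hu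
  -- radii and levels
  set Rk : ℝ := 2 * Real.arsinh (Real.sqrt Mk) with hRk
  set R0 : ℝ := 2 * Real.arsinh (Real.sqrt (dyadicDelta 0)) with hR0
  have hRk0 : 0 ≤ Rk := mul_nonneg zero_le_two (Real.arsinh_nonneg_iff.mpr (Real.sqrt_nonneg _))
  have hR00 : 0 ≤ R0 := mul_nonneg zero_le_two (Real.arsinh_nonneg_iff.mpr (Real.sqrt_nonneg _))
  have hRm : ∀ m, Real.exp (2 * Real.arsinh (Real.sqrt (dyadicDelta m))) ≤ Real.exp R0 := fun m =>
    Real.exp_le_exp.mpr (tentRadius_le m)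
  set Y2 : ℝ := Real.exp Rk with hY2def
  set Yk : ℝ := Real.exp R0 * Real.exp R0 with hYk
  set Y1 : ℝ := Real.exp R0 * Y2 with hY1def
  set Y : ℝ := Yk * Y2 with hYdef
  have hYk1 : 1 ≤ Yk := one_le_mul_of_one_le_of_one_le (Real.one_le_exp hR00) (Real.one_le_exp hR00)
  have hY2 : 1 ≤ Y2 := Real.one_le_exp hRk0
  have hY1 : 1 ≤ Y1 := one_le_mul_of_one_le_of_one_le (Real.one_le_exp hR00) (Real.one_le_exp hRk0)
  have hY : 1 ≤ Y := one_le_mul_of_one_le_of_one_le hYk1 (Real.one_le_exp hRk0)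
  have hk_level : Yk * Real.exp (2 * Real.arsinh (Real.sqrt Mk)) ≤ Y := le_of_eq (by rw [hYdef, hY2def, hRk])
  have ht_level1 : ∀ m, Y1 * Real.exp (2 * Real.arsinh (Real.sqrt (dyadicDelta m))) ≤ Y := by
    intro m
    calc Y1 * Real.exp (2 * Real.arsinh (Real.sqrt (dyadicDelta m))) ≤ Y1 * Real.exp R0 :=
          mul_le_mul_of_nonneg_left (hRm m) (by positivity)
      _ = Y := by rw [hYdef, hYk, hY1def]; ring
  have ht_level2 : ∀ m, Y2 * Real.exp (2 * Real.arsinh (Real.sqrt (dyadicDelta m))) ≤ Y1 := by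
    intro m
    calc Y2 * Real.exp (2 * Real.arsinh (Real.sqrt (dyadicDelta m))) ≤ Y2 * Real.exp R0 :=
          mul_le_mul_of_nonneg_left (hRm m) (by positivity)
      _ = Y1 := by rw [hY1def]; ring
  -- the operators
  set T : L2F →L[ℂ] L2F := kernelCLM hΓ hneg hd hF hk hkc with hT
  have hTm_def : ∀ m, tentOp hΓ hneg hd hF m = kernelCLM hΓ hneg hd hF (htk m) (htkc m) := fun m => rfl
  set c : ℕ → ℝ := dyadicCoeff H with hc
  set β : ℝ := H (2 ^ M) with hβdef
  have hβ0 : 0 ≤ β := majorant_nonneg hHh (by positivity)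
  set N : L2F →L[ℂ] L2F := (s : ℂ) • T - ∑ m ∈ Finset.range (M + 1), (c m : ℂ) • (tentOp hΓ hneg hd hF m * tentOp hΓ hneg hd hF m)
    with hNdef
  have hN_apply : ∀ g : L2F, N g = (s : ℂ) • T g -
      ∑ m ∈ Finset.range (M + 1), (c m : ℂ) • tentOp hΓ hneg hd hF m (tentOp hΓ hneg hd hF m g) := by
    intro g
    rw [hNdef, sub_apply, smul_apply, _root_.sum_apply]
    rfl
  have hTsa : IsSelfAdjoint T := isSelfAdjoint_kernelCLM hΓ hneg hd hF hk hkc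
  have hTmsa : ∀ m, IsSelfAdjoint (tentOp hΓ hneg hd hF m) := fun m => isSelfAdjoint_kernelCLM hΓ hneg hd hF (htk m) (htkc m)
  have hsa_inner : ∀ {X : L2F →L[ℂ] L2F}, IsSelfAdjoint X → ∀ a b : L2F, ⟪X a, b⟫_ℂ = ⟪a, X b⟫_ℂ := by
    intro X hX a b
    rw [← ContinuousLinearMap.adjoint_inner_right X a b, hX.adjoint_eq]
  -- the form of `N` on a vector
  have hN_inner : ∀ x y : L2F, ⟪N x, y⟫_ℂ = (s : ℂ) * ⟪T x, y⟫_ℂ -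
      ∑ m ∈ Finset.range (M + 1), (c m : ℂ) * ⟪tentOp hΓ hneg hd hF m (tentOp hΓ hneg hd hF m x), y⟫_ℂ := by
    intro x y
    rw [hN_apply, inner_sub_left, inner_smul_left, Complex.conj_ofReal, sum_inner]
    congr 1
    exact Finset.sum_congr rfl fun m _ => by rw [inner_smul_left, Complex.conj_ofReal]
  -- (1) self-adjointness
  have hreal : ∀ r : ℝ, IsSelfAdjoint (r : ℂ) := fun r => Complex.conj_ofReal r
  have hsq_sa : ∀ m, IsSelfAdjoint (tentOp hΓ hneg hd hF m * tentOp hΓ hneg hd hF m) := fun m => by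
    rw [IsSelfAdjoint, star_mul, (hTmsa m).star_eq]
  have hNsa : IsSelfAdjoint N :=
    ((hreal s).smul hTsa).sub (isSelfAdjoint_sum _ fun m _ => (hreal (c m)).smul (hsq_sa m))
  -- (2) commutation with the `T_{k'}`
  have hNcomm : ∀ (k' : ℝ → ℝ) (hk' : IsTestKernel k') (L : ℝ≥0) (hL : LipschitzWith L k'),
      Commute N (kernelCLM hΓ hneg hd hF hk' hL.continuous) := by
    intro k' hk' L hL
    have h1 : Commute T (kernelCLM hΓ hneg hd hF hk' hL.continuous) := commute_kernelCLM hΓ hneg hd hF hk hkc hk' hL.continuous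
    have h2 : ∀ m, Commute (tentOp hΓ hneg hd hF m) (kernelCLM hΓ hneg hd hF hk' hL.continuous) := fun m =>
      commute_kernelCLM hΓ hneg hd hF (htk m) (htkc m) hk' hL.continuous
    exact (h1.smul_left _).sub_left (Commute.sum_left _ _ _ fun m _ => ((h2 m).mul_left (h2 m)).smul_left _)
  -- (3) compactness of `N Λ`
  have hNcpt : IsCompactOperator (N ∘L truncOp hΓ hneg hd hF hper hY) := by
    set Λ := truncOp hΓ hneg hd hF hper hY with hΛ
    have hTΛ : IsCompactOperator (T ∘L Λ) :=
      isCompactOperator_kernelCLM_comp_truncOp_of_continuous hΓ hneg hd hF hvol hinfty hper hineq hcomplete hY hk hkc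
    have hTmΛ : ∀ m, IsCompactOperator (tentOp hΓ hneg hd hF m ∘L (tentOp hΓ hneg hd hF m ∘L Λ)) := fun m =>
      (isCompactOperator_kernelCLM_comp_truncOp hΓ hneg hd hF hvol hinfty hper hineq hcomplete hY (htk m) (htL m)
        (htM m) (dyadicDelta_pos m).le).clm_comp (tentOp hΓ hneg hd hF m)
    have e : N ∘L Λ = (s : ℂ) • (T ∘L Λ) -
        ∑ m ∈ Finset.range (M + 1), (c m : ℂ) • (tentOp hΓ hneg hd hF m ∘L (tentOp hΓ hneg hd hF m ∘L Λ)) := by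
      rw [hNdef, ContinuousLinearMap.sub_comp, ContinuousLinearMap.smul_comp, ContinuousLinearMap.finsetSum_comp]
      rfl
    rw [e]
    have hmem : ∀ {X : L2F →L[ℂ] L2F}, IsCompactOperator X ↔ X ∈ compactOperator (RingHom.id ℂ) L2F L2F := fun {X} => Iff.rfl
    rw [hmem]
    refine Submodule.sub_mem _ (Submodule.smul_mem _ _ ((hmem).mp hTΛ)) (Submodule.sum_mem _ fun m _ =>
      Submodule.smul_mem _ _ ((hmem).mp (hTmΛ m)))
  -- (4) the cusp form bound
  have hform : ∀ g : L2F, (⟪N (cuspQ hΓ hneg hd hF hper hY g), cuspQ hΓ hneg hd hF hper hY g⟫_ℂ).re ≤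
      β * ‖cuspQ hΓ hneg hd hF hper hY g‖ ^ 2 := by
    refine re_inner_cuspQ_le_of_nice hΓ hneg hd hF hinfty hper hineq hY (fun i b Ψ hΨ => ?_) (fun i j hij b b' Ψ Ψ' hΨ hΨ' => ?_)
    · -- diagonal
      obtain ⟨hTk, hC1, hC2⟩ := inner_kernelCLM_cuspV_nice hΓ hneg hd hF hper hk hkc hMk hMk0 hYk1 hk_level hY i hΨ
      have hTt : ∀ m, ⟪tentOp hΓ hneg hd hF m (tentOp hΓ hneg hd hF m (cuspV hΓ hneg hd hF hper hY i (hΨ.memLp.toLp Ψ))),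
          cuspV hΓ hneg hd hF hper hY i (hΨ.memLp.toLp Ψ)⟫_ℂ =
          ∫ v, conj (((fun r => ((selbergG (tentKernel (dyadicDelta m)) r : ℝ) : ℂ)) ⋆[ContinuousLinearMap.mul ℂ ℂ] Ψ) v) *
            ((fun r => ((selbergG (tentKernel (dyadicDelta m)) r : ℝ) : ℂ)) ⋆[ContinuousLinearMap.mul ℂ ℂ] Ψ) v := fun m =>
        inner_kernelCLM_sq_cuspV_nice hΓ hneg hd hF hper (htk m) (htkc m) (htM m) (dyadicDelta_pos m).le hY1
          (ht_level1 m) hY i hΨ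
      have hCt : ∀ m, Integrable ((fun r => ((selbergG (tentKernel (dyadicDelta m)) r : ℝ) : ℂ)) ⋆[ContinuousLinearMap.mul ℂ ℂ] Ψ) ∧
          MemLp ((fun r => ((selbergG (tentKernel (dyadicDelta m)) r : ℝ) : ℂ)) ⋆[ContinuousLinearMap.mul ℂ ℂ] Ψ) 2
            (volume : Measure ℝ) := fun m =>
        (inner_kernelCLM_cuspV_nice hΓ hneg hd hF hper (htk m) (htkc m) (htM m) (dyadicDelta_pos m).le hY1
          (ht_level1 m) hY i hΨ).2
      obtain ⟨BΨ, hBΨ⟩ := hΨ.bounded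
      obtain ⟨hΨ1, hΨ2⟩ := integrable_and_memLp_of_bounded_support hΨ.measurable hBΨ hΨ.eq_zero_of_le hΨ.eq_zero_of_ge
      rw [hN_inner, hTk]
      simp_rw [hTt]
      have key := re_symbolForm_le hk htk (A := Finset.range (M + 1)) (s := s) (c := c) (β := β)
        (fun t => symbol_le hH hHh hs M t) hΨ1 hΨ2 hC1 hC2 (fun m => (hCt m).1) (fun m => (hCt m).2)
      rw [norm_toLp_nice_sq hΨ]
      exact key
    · -- cross terms
      rw [hN_inner, inner_kernelCLM_cuspV_cross hΓ hneg hd hF hinfty hper hineq hk hkc hMk hMk0 hYk1 hk_level hY hij hΨ hΨ',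
        mul_zero, zero_sub, neg_eq_zero]
      refine Finset.sum_eq_zero fun m _ => ?_
      rw [hTm_def m, inner_kernelCLM_sq_cuspV_cross hΓ hneg hd hF hinfty hper hineq (htk m) (htkc m) (htM m)
        (dyadicDelta_pos m).le hY1 (ht_level1 m) hY hij hΨ hΨ', mul_zero]
  -- (5) the symbol on eigenfunctions
  set symb : ℂ → ℂ := fun t => (s : ℂ) * selbergTransform k t -
    ∑ m ∈ Finset.range (M + 1), (c m : ℂ) * selbergTransform (tentKernel (dyadicDelta m)) t ^ 2 with hsymb_def
  have hsymb : ∀ (u : ℍ → ℂ) (t : ℂ) (v : L2F), IsDeltaEigenfunction Γ u t →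
      u =ᵐ[(volume : Measure ℍ).restrict F] v → N v = symb t • v := by
    intro u t v hu huv
    have h1 : T v = selbergTransform k t • v := kernelCLM_eq_smul_of_eigenfunction hΓ hneg hd hF hk hkc hu huv
    have h2 : ∀ m, tentOp hΓ hneg hd hF m v = selbergTransform (tentKernel (dyadicDelta m)) t • v := fun m =>
      kernelCLM_eq_smul_of_eigenfunction hΓ hneg hd hF (htk m) (htkc m) hu huv
    rw [hN_apply, h1, smul_smul]
    have h3 : ∀ m, (c m : ℂ) • tentOp hΓ hneg hd hF m (tentOp hΓ hneg hd hF m v) =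
        ((c m : ℂ) * selbergTransform (tentKernel (dyadicDelta m)) t ^ 2) • v := by
      intro m
      rw [h2 m, map_smul, h2 m, smul_smul, smul_smul, sq, mul_assoc]
    simp_rw [h3]
    rw [← Finset.sum_smul, ← sub_smul]
  -- (6) the symbol inequality on the real line
  have hβs : ∀ t : ℝ, (symb t).re ≤ β := by
    intro t
    have hsqre : ∀ m, (selbergTransform (tentKernel (dyadicDelta m)) t ^ 2).re =
        (selbergTransform (tentKernel (dyadicDelta m)) t).re ^ 2 := by
      intro m
      rw [selbergTransform_ofReal_eq_re _ t, ← Complex.ofReal_pow, Complex.ofReal_re, Complex.ofReal_re]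
    have e : (symb t).re = s * (selbergTransform k t).re -
        ∑ m ∈ Finset.range (M + 1), c m * (selbergTransform (tentKernel (dyadicDelta m)) t).re ^ 2 := by
      rw [hsymb_def]
      simp only [Complex.sub_re, Complex.re_sum, Complex.mul_re, Complex.ofReal_re, Complex.ofReal_im, zero_mul, sub_zero,
        hsqre]
    rw [e]
    exact symbol_le hH hHh hs M t
  -- apply the form bound on `Sᗮ`
  have key := re_inner_le_of_symbol_le hΓ hneg hd hF hinfty hper hineq B hY hNsa hNcomm hNcpt hβ0 hform symb hsymb hβs f hf
  -- unfold `⟨N f, f⟩`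
  rw [hN_inner] at key
  have hsq : ∀ m, ⟪tentOp hΓ hneg hd hF m (tentOp hΓ hneg hd hF m f), f⟫_ℂ = ((‖tentOp hΓ hneg hd hF m f‖ ^ 2 : ℝ) : ℂ) := by
    intro m
    rw [hsa_inner (hTmsa m), inner_self_eq_norm_sq_to_K]
    norm_cast
  simp_rw [hsq] at key
  have e : ((s : ℂ) * ⟪T f, f⟫_ℂ - ∑ m ∈ Finset.range (M + 1), (c m : ℂ) * ((‖tentOp hΓ hneg hd hF m f‖ ^ 2 : ℝ) : ℂ)).re =
      s * (⟪T f, f⟫_ℂ).re - ∑ m ∈ Finset.range (M + 1), c m * ‖tentOp hΓ hneg hd hF m f‖ ^ 2 := by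
    simp only [Complex.sub_re, Complex.re_sum, Complex.mul_re, Complex.ofReal_re, Complex.ofReal_im, zero_mul, sub_zero]
  rw [e] at key
  exact key

end Main

end Fuchsian

/-! ## 4. The projection onto the small eigenfunctions -/

section Proj

/-- `proj x = Σ_j ⟨e_j, x⟩ e_j`, the orthogonal projection onto the span of the small eigenfunctions
(written out on the orthonormal family `e_j`). [cite: Iwaniec2002, Thm 7.3 & (7.17), PDF pp. 74–76] -/
def SmallEigenbasis.proj (B : SmallEigenbasis Γ F) (x : Lp ℂ 2 ((volume : Measure ℍ).restrict F)) :
    Lp ℂ 2 ((volume : Measure ℍ).restrict F) :=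
  ∑ j, ⟪B.vec j, x⟫_ℂ • B.vec j

/-- `x - proj x ⊥ e_i`. [folklore] -/
theorem SmallEigenbasis.inner_vec_sub_proj (B : SmallEigenbasis Γ F) (x : Lp ℂ 2 ((volume : Measure ℍ).restrict F))
    (i : Fin B.n) : ⟪B.vec i, x - B.proj x⟫_ℂ = 0 := by
  classical
  rw [inner_sub_right, SmallEigenbasis.proj, inner_sum]
  simp_rw [inner_smul_right, B.inner_vec]
  rw [Finset.sum_eq_single i (fun j _ hji => by rw [if_neg (Ne.symm hji), mul_zero])
    (fun h => absurd (Finset.mem_univ i) h), if_pos rfl, mul_one, sub_self]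

/-- `proj` is linear: `proj (x + c y) = proj x + c proj y`. [folklore] -/
theorem SmallEigenbasis.proj_add_smul (B : SmallEigenbasis Γ F) (x y : Lp ℂ 2 ((volume : Measure ℍ).restrict F))
    (c : ℂ) : B.proj (x + c • y) = B.proj x + c • B.proj y := by
  simp only [SmallEigenbasis.proj, inner_add_right, inner_smul_right, add_smul, mul_smul, Finset.sum_add_distrib,
    Finset.smul_sum]

/-- `(x + c y) - proj (x + c y) = (x - proj x) + c (y - proj y)`. [folklore] -/
theorem SmallEigenbasis.sub_proj_add_smul (B : SmallEigenbasis Γ F) (x y : Lp ℂ 2 ((volume : Measure ℍ).restrict F))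
    (c : ℂ) : (x + c • y) - B.proj (x + c • y) = (x - B.proj x) + c • (y - B.proj y) := by
  rw [B.proj_add_smul, smul_sub]
  abel

variable (hΓ : Γ ≤ (Matrix.SpecialLinearGroup.toGL : SL(2, ℝ) →* GL (Fin 2) ℝ).range)
  (hneg : (-1 : GL (Fin 2) ℝ) ∈ Γ) (hd : IsDiscreteSubgroup Γ) (hF : IsHypFundamentalDomain Γ F)

include hΓ hneg hd hF in
/-- `T_k (proj x) = Σ_j ⟨e_j, x⟩ h(t_j) e_j`. [cite: Iwaniec2002, Thm 1.16 & (7.17), PDF pp. 24, 76] -/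
theorem SmallEigenbasis.kernelCLM_proj (B : SmallEigenbasis Γ F) {k : ℝ → ℝ} (hk : IsTestKernel k) (hkc : Continuous k)
    (x : Lp ℂ 2 ((volume : Measure ℍ).restrict F)) :
    kernelCLM hΓ hneg hd hF hk hkc (B.proj x) =
      ∑ j, (⟪B.vec j, x⟫_ℂ * selbergTransform k (Complex.I * ((B.s j - 1 / 2 : ℝ) : ℂ))) • B.vec j := by
  rw [SmallEigenbasis.proj, map_sum]
  refine Finset.sum_congr rfl fun j _ => ?_
  rw [map_smul, B.kernelCLM_vec hΓ hneg hd hF hk hkc j, smul_smul]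

include hΓ hneg hd hF in
/-- `|h(t_j)| ≤ ‖T_k‖` (`T_k e_j = h(t_j) e_j`, `‖e_j‖ = 1`). [folklore] -/
theorem SmallEigenbasis.norm_selbergTransform_le_opNorm (B : SmallEigenbasis Γ F) {k : ℝ → ℝ} (hk : IsTestKernel k)
    (hkc : Continuous k) (j : Fin B.n) :
    ‖selbergTransform k (Complex.I * ((B.s j - 1 / 2 : ℝ) : ℂ))‖ ≤ ‖kernelCLM hΓ hneg hd hF hk hkc‖ := by
  have h1 : ‖B.vec j‖ = 1 := B.orthonormal_vec.norm_eq_one j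
  have h2 := (kernelCLM hΓ hneg hd hF hk hkc).le_opNorm (B.vec j)
  rw [B.kernelCLM_vec hΓ hneg hd hF hk hkc j, norm_smul, h1, mul_one, mul_one] at h2
  exact h2

include hΓ hneg hd hF in
/-- `‖T_k (proj x)‖ ≤ ‖T_k‖ Σ_j |⟨e_j, x⟩|`. [folklore] -/
theorem SmallEigenbasis.norm_kernelCLM_proj_le (B : SmallEigenbasis Γ F) {k : ℝ → ℝ} (hk : IsTestKernel k)
    (hkc : Continuous k) (x : Lp ℂ 2 ((volume : Measure ℍ).restrict F)) :
    ‖kernelCLM hΓ hneg hd hF hk hkc (B.proj x)‖ ≤ ‖kernelCLM hΓ hneg hd hF hk hkc‖ * ∑ j, ‖⟪B.vec j, x⟫_ℂ‖ := by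
  rw [B.kernelCLM_proj hΓ hneg hd hF hk hkc x, Finset.mul_sum]
  refine (norm_sum_le _ _).trans (Finset.sum_le_sum fun j _ => ?_)
  rw [norm_smul, B.orthonormal_vec.norm_eq_one j, mul_one, norm_mul, mul_comm]
  exact mul_le_mul_of_nonneg_right (B.norm_selbergTransform_le_opNorm hΓ hneg hd hF hk hkc j) (norm_nonneg _)

include hΓ hneg hd hF in
/-- **The form on the projected vectors**:
`⟨y - proj y, T_k (x - proj x)⟩ = ⟨y, T_k x⟩ - Σ_j ⟨e_j, x⟩ h(t_j) ⟨y, e_j⟩`. [cite: Iwaniec2002, (7.17), PDF p. 76] -/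
theorem SmallEigenbasis.inner_sub_proj_kernelCLM_sub_proj (B : SmallEigenbasis Γ F) {k : ℝ → ℝ} (hk : IsTestKernel k)
    (hkc : Continuous k) (x y : Lp ℂ 2 ((volume : Measure ℍ).restrict F)) :
    ⟪y - B.proj y, kernelCLM hΓ hneg hd hF hk hkc (x - B.proj x)⟫_ℂ =
      ⟪y, kernelCLM hΓ hneg hd hF hk hkc x⟫_ℂ -
        ∑ j, ⟪B.vec j, x⟫_ℂ * selbergTransform k (Complex.I * ((B.s j - 1 / 2 : ℝ) : ℂ)) * ⟪y, B.vec j⟫_ℂ := by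
  set T := kernelCLM hΓ hneg hd hF hk hkc with hT
  have hsa : IsSelfAdjoint T := isSelfAdjoint_kernelCLM hΓ hneg hd hF hk hkc
  -- `⟨proj y, T (x - proj x)⟩ = 0`
  have h0 : ⟪B.proj y, T (x - B.proj x)⟫_ℂ = 0 := by
    rw [← ContinuousLinearMap.adjoint_inner_left, hsa.adjoint_eq, B.kernelCLM_proj hΓ hneg hd hF hk hkc y, sum_inner]
    refine Finset.sum_eq_zero fun j _ => ?_
    rw [inner_smul_left, B.inner_vec_sub_proj x j, mul_zero]
  rw [inner_sub_left, h0, sub_zero, map_sub, inner_sub_right, B.kernelCLM_proj hΓ hneg hd hF hk hkc x, inner_sum]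
  congr 1
  refine Finset.sum_congr rfl fun j _ => ?_
  rw [inner_smul_right]

end Proj

namespace Fuchsian

variable {h : ℕ} {𝔞 : Fin h → OnePoint ℝ} {σ : Fin h → SL(2, ℝ)}

set_option quotPrecheck false in
/-- `L²(F)`. -/
local notation "L2F" => Lp ℂ 2 ((volume : Measure ℍ).restrict F)

/-! ## 5. The uniform bounds -/

section Bounds

variable (hΓ : Γ ≤ (Matrix.SpecialLinearGroup.toGL : SL(2, ℝ) →* GL (Fin 2) ℝ).range)
  (hneg : (-1 : GL (Fin 2) ℝ) ∈ Γ) (hd : IsDiscreteSubgroup Γ) (hF : IsHypFundamentalDomain Γ F)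

/-- The local lattice count `N(w₀) = #{γ ∈ Γ : ρ(γ w₀, w₀) ≤ 2 arsinh √8 + 2}` bounding the orbit
counts of Proposition 7.2 near `w₀`. [cite: Iwaniec2002, proof of Prop. 7.2, PDF p. 73] -/
def nearCount (w₀ : ℍ) : ℕ := (finite_dist_le hΓ hd w₀ w₀ (2 * Real.arsinh (Real.sqrt 8) + 2)).toFinset.card

include hΓ hneg hd hF in
/-- `‖T_m‖ ≤ 2π δ_m` (Schur bound, `∫ k_δ = δ/2`). [cite: Iwaniec2002, §1.8, PDF pp. 20–21] -/
theorem norm_tentOp_le (m : ℕ) : ‖tentOp hΓ hneg hd hF m‖ ≤ 2 * π * dyadicDelta m := by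
  have hδ := dyadicDelta_pos m
  refine (norm_kernelCLM_le hΓ hneg hd hF _ _).trans (le_of_eq ?_)
  rw [schurConst, integral_congr_ae (g := tentKernel (dyadicDelta m))
    (Eventually.of_forall fun u => abs_of_nonneg (tentKernel_nonneg _ _)), integral_tentKernel hδ]
  ring

/-- A point of the `δ`-ball about `w₀` (`δ ≤ 1/64`) is at distance `< 1`. [folklore] -/
theorem dist_lt_one_of_pointPairInv_le {δ : ℝ} (hδ1 : δ ≤ 1 / 64) {w₀ v : ℍ} (h : pointPairInv w₀ v ≤ δ) :
    dist v w₀ < 1 := by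
  rw [dist_comm]
  refine lt_of_le_of_lt (dist_le_of_pointPairInv_le h) ?_
  have h1 : Real.arsinh (Real.sqrt δ) ≤ Real.arsinh (1 / 8) := by
    rw [Real.arsinh_le_arsinh]
    calc Real.sqrt δ ≤ Real.sqrt (1 / 64) := Real.sqrt_le_sqrt hδ1
      _ = 1 / 8 := by rw [show (1 / 64 : ℝ) = (1 / 8) ^ 2 by norm_num, Real.sqrt_sq (by norm_num)]
  have h2 : Real.arsinh (1 / 8) < 1 / 2 := by
    have : (1 / 8 : ℝ) < Real.sinh (1 / 2) :=
      lt_trans (by norm_num) (Real.self_lt_sinh_iff.mpr (by norm_num : (0 : ℝ) < 1 / 2))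
    have := Real.arsinh_lt_arsinh.mpr this
    rwa [Real.arsinh_sinh] at this
  linarith

include hΓ hneg hd hF in
/-- **`‖T_m G_{w₀}^δ‖² ≤ 2π δ_m N(w₀)`** for `0 < δ ≤ 1/64`: the local Weyl input
(`∫_F K_{δ_m}(·, v')² ≤ 8π δ_m N_{δ_m}(v')`, `N_{δ_m}(v') ≤ N(w₀)` on the ball, Jensen and Tonelli).
[cite: Iwaniec2002, proof of Prop. 7.2 (7.10), PDF p. 73] -/
theorem norm_sq_tentOp_ballVec_le (m : ℕ) {δ : ℝ} (hδ : 0 < δ) (hδ1 : δ ≤ 1 / 64) (w₀ : ℍ) :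
    ‖tentOp hΓ hneg hd hF m (ballVec hΓ hneg hd hF δ w₀)‖ ^ 2 ≤ 2 * π * dyadicDelta m * (nearCount hΓ hd w₀ : ℝ) := by
  have hδm := dyadicDelta_pos m
  set Bd : ℝ≥0∞ := 2 * (nearCount hΓ hd w₀ : ℝ≥0∞) * ENNReal.ofReal (4 * π * dyadicDelta m) with hBd
  have hBtop : Bd ≠ ⊤ := ENNReal.mul_ne_top (ENNReal.mul_ne_top (by simp) (by simp)) ENNReal.ofReal_ne_top
  have hbound : ∀ v', pointPairInv w₀ v' ≤ δ →
      ∫⁻ v in F, ENNReal.ofReal (automorphicKernel Γ (tentKernel (dyadicDelta m)) v v' ^ 2) ≤ Bd := by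
    intro v' hv'
    refine (lintegral_automorphicKernel_tentKernel_sq_le hΓ hneg hd hF hδm v').trans ?_
    have hN : orbitCount Γ (dyadicDelta m) v' ≤ nearCount hΓ hd w₀ :=
      orbitCount_le_near hΓ hd hδm.le (dyadicDelta_le_one m) w₀ (dist_lt_one_of_pointPairInv_le hδ1 hv')
    rw [hBd]
    gcongr
  have h := norm_sq_kernelCLM_ballVec_le hΓ hneg hd hF (isTestKernel_tentKernel hδm) (continuous_tentKernel hδm)
    (fun u => tentKernel_nonneg _ u) hδ w₀ hBtop hbound
  refine h.trans (le_of_eq ?_)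
  rw [hBd, ENNReal.toReal_mul, ENNReal.toReal_mul, ENNReal.toReal_ofReal (by positivity), ENNReal.toReal_ofNat,
    ENNReal.toReal_natCast]
  ring

include hΓ hneg hd hF in
/-- **`|⟨e_j, G_{w₀}^δ⟩| ≤ 2 |u_j(w₀)|`** for `0 < δ ≤ 1/256` (`⟨e_j, G_{w₀}^δ⟩ = (4πδ)⁻¹ h_δ(t_j) ū_j(w₀)`
and `|h_δ(t_j)| ≤ 6πδ`, `t_j = i(s_j - ½)`, `|1 - s_j| ≤ ½`). [cite: Iwaniec2002, proof of Prop. 7.2, PDF p. 73] -/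
theorem norm_inner_vec_ballVec_le (B : SmallEigenbasis Γ F) (j : Fin B.n) {δ : ℝ} (hδ : 0 < δ)
    (hδ1 : δ ≤ 1 / 256) (w₀ : ℍ) :
    ‖⟪B.vec j, ballVec hΓ hneg hd hF δ w₀⟫_ℂ‖ ≤ 2 * ‖B.u j w₀‖ := by
  have hδ64 : δ ≤ 1 / 64 := hδ1.trans (by norm_num)
  set t : ℂ := Complex.I * ((B.s j - 1 / 2 : ℝ) : ℂ) with ht
  have hinner : ⟪B.vec j, ballVec hΓ hneg hd hF δ w₀⟫_ℂ =
      (((8 * π * δ)⁻¹ : ℝ) : ℂ) * (2 * selbergTransform (ballKernel δ) t * conj (B.u j w₀)) :=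
    inner_toLp_ballVec hΓ hneg hd hF (B.isAutomorphic j) (B.isC2 j) (B.eigen j) (B.quarter_add_sq j) (B.memLp j) hδ w₀
  -- `|h_δ(t_j)| ≤ 6πδ`
  have hs : ‖(1 / 2 : ℂ) + Complex.I * t‖ ≤ 1 / 2 := by
    have e : (1 / 2 : ℂ) + Complex.I * t = ((1 - B.s j : ℝ) : ℂ) := by
      rw [ht, ← mul_assoc, Complex.I_mul_I]
      push_cast
      ring
    rw [e, Complex.norm_real, Real.norm_eq_abs, abs_le]
    obtain ⟨h1, h2⟩ := B.s_mem j
    constructor <;> linarith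
  have hsmall : ‖(1 / 2 : ℂ) + Complex.I * t‖ * (32 * Real.sqrt δ) ≤ 1 := by
    have hsq : Real.sqrt δ ≤ 1 / 16 := by
      calc Real.sqrt δ ≤ Real.sqrt (1 / 256) := Real.sqrt_le_sqrt hδ1
        _ = 1 / 16 := by rw [show (1 / 256 : ℝ) = (1 / 16) ^ 2 by norm_num, Real.sqrt_sq (by norm_num)]
    calc ‖(1 / 2 : ℂ) + Complex.I * t‖ * (32 * Real.sqrt δ) ≤ (1 / 2) * (32 * (1 / 16)) := by
          gcongr
      _ = 1 := by norm_num
  have hh : ‖selbergTransform (ballKernel δ) t‖ ≤ 6 * π * δ := by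
    have h1 := norm_selbergTransform_ballKernel_sub_le hδ hδ64 t hsmall
    have h2 : 16 * ‖(1 / 2 : ℂ) + Complex.I * t‖ * Real.sqrt δ * (4 * π * δ) ≤ 2 * π * δ := by
      have hsq : Real.sqrt δ ≤ 1 / 16 := by
        calc Real.sqrt δ ≤ Real.sqrt (1 / 256) := Real.sqrt_le_sqrt hδ1
          _ = 1 / 16 := by rw [show (1 / 256 : ℝ) = (1 / 16) ^ 2 by norm_num, Real.sqrt_sq (by norm_num)]
      calc 16 * ‖(1 / 2 : ℂ) + Complex.I * t‖ * Real.sqrt δ * (4 * π * δ) ≤ 16 * (1 / 2) * (1 / 16) * (4 * π * δ) := by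
            gcongr
        _ = 2 * π * δ := by ring
    have h3 : ‖((4 * π * δ : ℝ) : ℂ)‖ = 4 * π * δ := by
      rw [Complex.norm_real, Real.norm_eq_abs, abs_of_pos (by positivity)]
    -- `‖a‖ ≤ ‖b‖ + ‖a - b‖`
    have h4 : ‖selbergTransform (ballKernel δ) t‖ ≤ ‖((4 * π * δ : ℝ) : ℂ)‖ + ‖selbergTransform (ballKernel δ) t - ((4 * π * δ : ℝ) : ℂ)‖ :=
      norm_le_norm_add_norm_sub' _ _
    rw [h3] at h4
    linarith
  rw [hinner, norm_mul, norm_mul, norm_mul, Complex.norm_real, Real.norm_eq_abs, abs_of_pos (by positivity),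
    Complex.norm_conj, Complex.norm_ofNat]
  calc (8 * π * δ)⁻¹ * (2 * ‖selbergTransform (ballKernel δ) t‖ * ‖B.u j w₀‖)
      ≤ (8 * π * δ)⁻¹ * (2 * (6 * π * δ) * ‖B.u j w₀‖) := by gcongr
    _ = (3 / 2) * ‖B.u j w₀‖ := by field_simp; ring
    _ ≤ 2 * ‖B.u j w₀‖ := by nlinarith [norm_nonneg (B.u j w₀)]

end Bounds

/-! ## 6. The bound for the forms on the projected approximate identities -/

section FormBound

variable (hΓ : Γ ≤ (Matrix.SpecialLinearGroup.toGL : SL(2, ℝ) →* GL (Fin 2) ℝ).range)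
  (hneg : (-1 : GL (Fin 2) ℝ) ∈ Γ) (hd : IsDiscreteSubgroup Γ) (hF : IsHypFundamentalDomain Γ F)
  (hvol : volume F < ⊤)
  (hinfty : ∀ i, (Matrix.SpecialLinearGroup.toGL (σ i) : GL (Fin 2) ℝ) • (OnePoint.infty : OnePoint ℝ) = 𝔞 i)
  (hper : ∀ i, (ConjAct.toConjAct (Matrix.SpecialLinearGroup.toGL (σ i) : GL (Fin 2) ℝ)⁻¹ • Γ).strictPeriods =
    AddSubgroup.zmultiples 1)
  (hineq : ∀ i j, ∀ γ ∈ Γ, γ • 𝔞 i = 𝔞 j → i = j)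
  (hcomplete : ∀ c : OnePoint ℝ, IsCusp c Γ → ∃ i, ∃ γ ∈ Γ, γ • 𝔞 i = c)

/-- The sum `U(z₀, w₀) = Σ_j 2 (|u_j(w₀)| + |u_j(z₀)|)` bounding the small coefficients. [folklore] -/
def smallCoeffBound (B : SmallEigenbasis Γ F) (w₀ z₀ : ℍ) : ℝ := ∑ j, 2 * (‖B.u j w₀‖ + ‖B.u j z₀‖)

/-- The constant `C₁(z₀, w₀) = (6/π) · 128² · 16 · (N(w₀) + N(z₀) + 2π U²)` of the form bound. [folklore] -/
def formConst (B : SmallEigenbasis Γ F) (w₀ z₀ : ℍ) : ℝ :=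
  6 / π * 128 ^ 2 * 16 * (nearCount hΓ hd w₀ + nearCount hΓ hd z₀ + 2 * π * smallCoeffBound B w₀ z₀ ^ 2)

/-- `U ≥ 0`. [folklore] -/
theorem smallCoeffBound_nonneg (B : SmallEigenbasis Γ F) (w₀ z₀ : ℍ) : 0 ≤ smallCoeffBound B w₀ z₀ :=
  Finset.sum_nonneg fun j _ => by positivity

/-- `C₁ ≥ 0`. [folklore] -/
theorem formConst_nonneg (B : SmallEigenbasis Γ F) (w₀ z₀ : ℍ) : 0 ≤ formConst hΓ hd B w₀ z₀ := by
  unfold formConst; positivity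

include hΓ hneg hd hF in
/-- **The dyadic operator sum on a projected approximate identity**: for
`x = G_{w₀}^δ + c G_{z₀}^{δ'}` (`|c| ≤ 1`, `0 < δ, δ' ≤ 1/256`) and `f = x - proj x`,
`Σ_{m ≤ M} c_m ‖T_m f‖² ≤ C₁ (H(0) + ∫ (t+1) H)`. [cite: Iwaniec2002, proof of (12.5) & Prop. 7.2, PDF pp. 73–76, 126] -/
theorem sum_coeff_norm_sq_le (B : SmallEigenbasis Γ F) {k : ℝ → ℝ}
    {H : ℝ → ℝ} (hH : AntitoneOn H (Ici 0)) (hHh : ∀ t : ℝ, 0 ≤ t → ‖selbergTransform k t‖ ≤ H t)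
    (hI : IntegrableOn (fun t => (t + 1) * H t) (Ioi 0))
    (w₀ z₀ : ℍ) {δ δ' : ℝ} (hδ : 0 < δ) (hδ1 : δ ≤ 1 / 256) (hδ' : 0 < δ') (hδ'1 : δ' ≤ 1 / 256)
    {cc : ℂ} (hcc : ‖cc‖ ≤ 1) (M : ℕ) :
    ∑ m ∈ Finset.range (M + 1), dyadicCoeff H m *
        ‖tentOp hΓ hneg hd hF m ((ballVec hΓ hneg hd hF δ w₀ + cc • ballVec hΓ hneg hd hF δ' z₀) -
          B.proj (ballVec hΓ hneg hd hF δ w₀ + cc • ballVec hΓ hneg hd hF δ' z₀))‖ ^ 2 ≤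
      formConst hΓ hd B w₀ z₀ * (H 0 + ∫ t in Ioi 0, (t + 1) * H t) := by
  set x : L2F := ballVec hΓ hneg hd hF δ w₀ + cc • ballVec hΓ hneg hd hF δ' z₀ with hx
  set Nw : ℝ := (nearCount hΓ hd w₀ : ℝ) with hNw
  set Nz : ℝ := (nearCount hΓ hd z₀ : ℝ) with hNz
  set U : ℝ := smallCoeffBound B w₀ z₀ with hU
  set Z : ℝ := Nw + Nz + 2 * π * U ^ 2 with hZ
  have hU0 : 0 ≤ U := smallCoeffBound_nonneg B w₀ z₀
  have hZ0 : 0 ≤ Z := by rw [hZ, hNw, hNz]; positivity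
  have hδ64 : δ ≤ 1 / 64 := hδ1.trans (by norm_num)
  have hδ'64 : δ' ≤ 1 / 64 := hδ'1.trans (by norm_num)
  -- the small coefficients of `x`
  have hcoef : ∑ j, ‖⟪B.vec j, x⟫_ℂ‖ ≤ U := by
    rw [hU, smallCoeffBound]
    refine Finset.sum_le_sum fun j _ => ?_
    rw [hx, inner_add_right, inner_smul_right]
    calc ‖⟪B.vec j, ballVec hΓ hneg hd hF δ w₀⟫_ℂ + cc * ⟪B.vec j, ballVec hΓ hneg hd hF δ' z₀⟫_ℂ‖
        ≤ ‖⟪B.vec j, ballVec hΓ hneg hd hF δ w₀⟫_ℂ‖ + ‖cc‖ * ‖⟪B.vec j, ballVec hΓ hneg hd hF δ' z₀⟫_ℂ‖ := by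
          refine (norm_add_le _ _).trans ?_; rw [norm_mul]
      _ ≤ 2 * ‖B.u j w₀‖ + 1 * (2 * ‖B.u j z₀‖) := by
          gcongr
          · exact norm_inner_vec_ballVec_le hΓ hneg hd hF B j hδ hδ1 w₀
          · exact norm_inner_vec_ballVec_le hΓ hneg hd hF B j hδ' hδ'1 z₀
      _ = 2 * (‖B.u j w₀‖ + ‖B.u j z₀‖) := by ring
  -- the per-`m` bound `‖T_m f‖² ≤ 6π δ_m Z`
  have hterm : ∀ m, ‖tentOp hΓ hneg hd hF m (x - B.proj x)‖ ^ 2 ≤ 6 * π * dyadicDelta m * Z := by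
    intro m
    have hδm := dyadicDelta_pos m
    have hδm1 := dyadicDelta_le_one m
    set Tm := tentOp hΓ hneg hd hF m with hTm
    have hA : ‖Tm (ballVec hΓ hneg hd hF δ w₀)‖ ^ 2 ≤ 2 * π * dyadicDelta m * Nw :=
      norm_sq_tentOp_ballVec_le hΓ hneg hd hF m hδ hδ64 w₀
    have hA' : ‖Tm (ballVec hΓ hneg hd hF δ' z₀)‖ ^ 2 ≤ 2 * π * dyadicDelta m * Nz :=
      norm_sq_tentOp_ballVec_le hΓ hneg hd hF m hδ' hδ'64 z₀
    have hP : ‖Tm (B.proj x)‖ ≤ 2 * π * dyadicDelta m * U := by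
      refine (B.norm_kernelCLM_proj_le hΓ hneg hd hF _ _ x).trans ?_
      exact mul_le_mul (norm_tentOp_le hΓ hneg hd hF m) hcoef (Finset.sum_nonneg fun j _ => norm_nonneg _) (by positivity)
    have h1 : ‖Tm (x - B.proj x)‖ ≤ ‖Tm (ballVec hΓ hneg hd hF δ w₀)‖ + ‖Tm (ballVec hΓ hneg hd hF δ' z₀)‖ + ‖Tm (B.proj x)‖ := by
      rw [map_sub, hx, map_add, map_smul]
      calc ‖Tm (ballVec hΓ hneg hd hF δ w₀) + cc • Tm (ballVec hΓ hneg hd hF δ' z₀) - Tm (B.proj x)‖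
          ≤ ‖Tm (ballVec hΓ hneg hd hF δ w₀) + cc • Tm (ballVec hΓ hneg hd hF δ' z₀)‖ + ‖Tm (B.proj x)‖ := norm_sub_le _ _
        _ ≤ ‖Tm (ballVec hΓ hneg hd hF δ w₀)‖ + ‖cc • Tm (ballVec hΓ hneg hd hF δ' z₀)‖ + ‖Tm (B.proj x)‖ := by
            gcongr; exact norm_add_le _ _
        _ ≤ ‖Tm (ballVec hΓ hneg hd hF δ w₀)‖ + ‖Tm (ballVec hΓ hneg hd hF δ' z₀)‖ + ‖Tm (B.proj x)‖ := by
            gcongr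
            rw [norm_smul]
            exact mul_le_of_le_one_left (norm_nonneg _) hcc
    -- square
    set a := ‖Tm (ballVec hΓ hneg hd hF δ w₀)‖ with ha
    set a' := ‖Tm (ballVec hΓ hneg hd hF δ' z₀)‖ with ha'
    set p := ‖Tm (B.proj x)‖ with hp
    have ha0 : 0 ≤ a := norm_nonneg _
    have ha'0 : 0 ≤ a' := norm_nonneg _
    have hp0 : 0 ≤ p := norm_nonneg _
    have h2 : ‖Tm (x - B.proj x)‖ ^ 2 ≤ (a + a' + p) ^ 2 := pow_le_pow_left₀ (norm_nonneg _) h1 2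
    have h3 : (a + a' + p) ^ 2 ≤ 3 * (a ^ 2 + a' ^ 2 + p ^ 2) := by nlinarith [sq_nonneg (a - a'), sq_nonneg (a - p), sq_nonneg (a' - p)]
    have hp2 : p ^ 2 ≤ (2 * π * dyadicDelta m * U) ^ 2 := pow_le_pow_left₀ hp0 hP 2
    have hδsq : dyadicDelta m ^ 2 ≤ dyadicDelta m := by nlinarith
    have h4 : 3 * (a ^ 2 + a' ^ 2 + p ^ 2) ≤ 6 * π * dyadicDelta m * Z :=
      calc 3 * (a ^ 2 + a' ^ 2 + p ^ 2)
          ≤ 3 * (2 * π * dyadicDelta m * Nw + 2 * π * dyadicDelta m * Nz + (2 * π * dyadicDelta m * U) ^ 2) := by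
            gcongr
        _ = 6 * π * dyadicDelta m * (Nw + Nz) + 12 * π ^ 2 * U ^ 2 * dyadicDelta m ^ 2 := by ring
        _ ≤ 6 * π * dyadicDelta m * (Nw + Nz) + 12 * π ^ 2 * U ^ 2 * dyadicDelta m := by
            gcongr
        _ = 6 * π * dyadicDelta m * Z := by rw [hZ]; ring
    linarith
  -- sum up with the dyadic bound
  have hcoef0 : ∀ m, 0 ≤ dyadicCoeff H m := fun m => dyadicCoeff_nonneg hHh m
  calc ∑ m ∈ Finset.range (M + 1), dyadicCoeff H m * ‖tentOp hΓ hneg hd hF m (x - B.proj x)‖ ^ 2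
      ≤ ∑ m ∈ Finset.range (M + 1), dyadicCoeff H m * (6 * π * dyadicDelta m * Z) :=
        Finset.sum_le_sum fun m _ => mul_le_mul_of_nonneg_left (hterm m) (hcoef0 m)
    _ = 6 / π * 128 ^ 2 * Z * ∑ m ∈ Finset.range (M + 1), 4 ^ m * H (dyadicLeft m) := by
        rw [Finset.mul_sum]
        refine Finset.sum_congr rfl fun m _ => ?_
        have hδ0 : dyadicDelta m ≠ 0 := (dyadicDelta_pos m).ne'
        have hinv := inv_dyadicDelta m
        have e1 : dyadicCoeff H m * (6 * π * dyadicDelta m * Z) = 6 / π * Z * H (dyadicLeft m) * (dyadicDelta m)⁻¹ := by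
          unfold dyadicCoeff
          field_simp
        rw [e1, hinv]
        ring
    _ ≤ 6 / π * 128 ^ 2 * Z * (16 * (H 0 + ∫ t in Ioi 0, (t + 1) * H t)) :=
        mul_le_mul_of_nonneg_left (sum_dyadic_le hH hHh hI M) (by positivity)
    _ = formConst hΓ hd B w₀ z₀ * (H 0 + ∫ t in Ioi 0, (t + 1) * H t) := by
        rw [formConst, hZ, hNw, hNz, hU]; ring

include hΓ hneg hd hF hvol hinfty hper hineq hcomplete in
/-- **The form bound on a projected approximate identity**: with the same `x`, `f = x - proj x`,
`|⟨T_k f, f⟩| ≤ C₁ (H(0) + ∫ (t+1) H)` (the operator inequality for `s = ±1`, `M → ∞` by the decay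
`H(2^M) ≤ 4 ∫(t+1)H / 4^M`, and `⟨T_k f, f⟩ ∈ ℝ`). [cite: Iwaniec2002, proof of (12.5), PDF p. 126] -/
theorem norm_inner_kernelCLM_self_le (B : SmallEigenbasis Γ F) {k : ℝ → ℝ} (hk : IsTestKernel k) (hkc : Continuous k)
    {H : ℝ → ℝ} (hH : AntitoneOn H (Ici 0)) (hHh : ∀ t : ℝ, 0 ≤ t → ‖selbergTransform k t‖ ≤ H t)
    (hI : IntegrableOn (fun t => (t + 1) * H t) (Ioi 0))
    (w₀ z₀ : ℍ) {δ δ' : ℝ} (hδ : 0 < δ) (hδ1 : δ ≤ 1 / 256) (hδ' : 0 < δ') (hδ'1 : δ' ≤ 1 / 256)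
    {cc : ℂ} (hcc : ‖cc‖ ≤ 1) :
    ‖⟪kernelCLM hΓ hneg hd hF hk hkc ((ballVec hΓ hneg hd hF δ w₀ + cc • ballVec hΓ hneg hd hF δ' z₀) -
          B.proj (ballVec hΓ hneg hd hF δ w₀ + cc • ballVec hΓ hneg hd hF δ' z₀)),
        (ballVec hΓ hneg hd hF δ w₀ + cc • ballVec hΓ hneg hd hF δ' z₀) -
          B.proj (ballVec hΓ hneg hd hF δ w₀ + cc • ballVec hΓ hneg hd hF δ' z₀)⟫_ℂ‖ ≤
      formConst hΓ hd B w₀ z₀ * (H 0 + ∫ t in Ioi 0, (t + 1) * H t) := by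
  set x : L2F := ballVec hΓ hneg hd hF δ w₀ + cc • ballVec hΓ hneg hd hF δ' z₀ with hx
  set f : L2F := x - B.proj x with hf
  set T := kernelCLM hΓ hneg hd hF hk hkc with hT
  set X : ℝ := H 0 + ∫ t in Ioi 0, (t + 1) * H t with hX
  set I : ℝ := ∫ t in Ioi 0, (t + 1) * H t with hIdef
  have hI0 : 0 ≤ I := setIntegral_nonneg measurableSet_Ioi fun t ht =>
    mul_nonneg (by linarith [Set.mem_Ioi.mp ht]) (majorant_nonneg hHh (le_of_lt (Set.mem_Ioi.mp ht)))
  have hfS : ∀ j, ⟪B.vec j, f⟫_ℂ = 0 := fun j => B.inner_vec_sub_proj x j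
  -- the operator inequality for both signs and all `M`
  have hmain : ∀ (s : ℝ), |s| ≤ 1 → s * (⟪T f, f⟫_ℂ).re ≤ formConst hΓ hd B w₀ z₀ * X := by
    intro s hs
    have hM : ∀ M : ℕ, s * (⟪T f, f⟫_ℂ).re ≤ formConst hΓ hd B w₀ z₀ * X + 4 * I * ‖f‖ ^ 2 / 4 ^ M := by
      intro M
      have h1 := pretrace_form_bound hΓ hneg hd hF hvol hinfty hper hineq hcomplete B hk hkc hH hHh hs M f hfS
      have h2 := sum_coeff_norm_sq_le hΓ hneg hd hF B hH hHh hI w₀ z₀ hδ hδ1 hδ' hδ'1 hcc M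
      have h3 : H (2 ^ M) ≤ 4 * I / 4 ^ M := by
        have h4 := majorant_mul_sq_le hH hHh hI (T := 2 ^ M / 2) (by positivity)
        rw [show 2 * ((2 : ℝ) ^ M / 2) = 2 ^ M by ring] at h4
        rw [le_div_iff₀ (by positivity)]
        have : ((2 : ℝ) ^ M / 2) ^ 2 = 4 ^ M / 4 := by
          rw [div_pow, ← pow_mul, show (2 : ℝ) ^ (M * 2) = 4 ^ M by rw [pow_mul']; norm_num]; norm_num
        rw [this] at h4
        nlinarith [h4]
      have h5 : H (2 ^ M) * ‖f‖ ^ 2 ≤ 4 * I / 4 ^ M * ‖f‖ ^ 2 := mul_le_mul_of_nonneg_right h3 (sq_nonneg _)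
      have : 4 * I / 4 ^ M * ‖f‖ ^ 2 = 4 * I * ‖f‖ ^ 2 / 4 ^ M := by ring
      linarith
    -- `M → ∞`
    have hlim : Tendsto (fun M : ℕ => formConst hΓ hd B w₀ z₀ * X + 4 * I * ‖f‖ ^ 2 / 4 ^ M) atTop
        (𝓝 (formConst hΓ hd B w₀ z₀ * X + 0)) := by
      refine tendsto_const_nhds.add ?_
      have h0 := (tendsto_pow_atTop_nhds_zero_of_lt_one (show (0 : ℝ) ≤ 4⁻¹ by norm_num)
        (by norm_num)).const_mul (4 * I * ‖f‖ ^ 2)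
      rw [mul_zero] at h0
      refine h0.congr fun M => ?_
      rw [div_eq_mul_inv, inv_pow]
    rw [add_zero] at hlim
    exact ge_of_tendsto' hlim hM
  -- `⟨T f, f⟩` is real
  have hreal : (⟪T f, f⟫_ℂ).im = 0 := by
    have hsa : IsSelfAdjoint T := isSelfAdjoint_kernelCLM hΓ hneg hd hF hk hkc
    have h1 : ⟪T f, f⟫_ℂ = conj ⟪T f, f⟫_ℂ := by
      rw [inner_conj_symm, ← ContinuousLinearMap.adjoint_inner_right, hsa.adjoint_eq]
    have := congrArg Complex.im h1
    rw [Complex.conj_im] at this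
    linarith
  have hnorm : ‖⟪T f, f⟫_ℂ‖ = |(⟪T f, f⟫_ℂ).re| := by
    have hz : ⟪T f, f⟫_ℂ = ((⟪T f, f⟫_ℂ).re : ℂ) := Complex.ext (by simp) (by simp [hreal])
    conv_lhs => rw [hz]
    rw [Complex.norm_real, Real.norm_eq_abs]
  rw [hnorm, abs_le]
  constructor
  · have := hmain (-1) (by norm_num); linarith
  · have := hmain 1 (by norm_num); linarith

include hΓ hneg hd hF hvol hinfty hper hineq hcomplete in
/-- **Polarisation**: `|⟨T_k a', b'⟩| ≤ C₁ (H(0) + ∫ (t+1) H)` for `a' = G_{w₀}^δ - proj G_{w₀}^δ`,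
`b' = G_{z₀}^{δ'} - proj G_{z₀}^{δ'}`, `0 < δ, δ' ≤ 1/256`. [cite: Iwaniec2002, proof of (12.5), PDF p. 126] -/
theorem norm_inner_kernelCLM_proj_le (B : SmallEigenbasis Γ F) {k : ℝ → ℝ} (hk : IsTestKernel k) (hkc : Continuous k)
    {H : ℝ → ℝ} (hH : AntitoneOn H (Ici 0)) (hHh : ∀ t : ℝ, 0 ≤ t → ‖selbergTransform k t‖ ≤ H t)
    (hI : IntegrableOn (fun t => (t + 1) * H t) (Ioi 0))
    (w₀ z₀ : ℍ) {δ δ' : ℝ} (hδ : 0 < δ) (hδ1 : δ ≤ 1 / 256) (hδ' : 0 < δ') (hδ'1 : δ' ≤ 1 / 256) :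
    ‖⟪kernelCLM hΓ hneg hd hF hk hkc (ballVec hΓ hneg hd hF δ w₀ - B.proj (ballVec hΓ hneg hd hF δ w₀)),
        ballVec hΓ hneg hd hF δ' z₀ - B.proj (ballVec hΓ hneg hd hF δ' z₀)⟫_ℂ‖ ≤
      formConst hΓ hd B w₀ z₀ * (H 0 + ∫ t in Ioi 0, (t + 1) * H t) := by
  set a : L2F := ballVec hΓ hneg hd hF δ w₀ with ha
  set b : L2F := ballVec hΓ hneg hd hF δ' z₀ with hb
  set a' : L2F := a - B.proj a with ha'
  set b' : L2F := b - B.proj b with hb'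
  set T := kernelCLM hΓ hneg hd hF hk hkc with hT
  set X : ℝ := H 0 + ∫ t in Ioi 0, (t + 1) * H t with hX
  set C₁ := formConst hΓ hd B w₀ z₀ with hC₁
  -- the four vectors of the polarisation identity
  have hQ : ∀ cc : ℂ, ‖cc‖ ≤ 1 → ‖⟪T (a' + cc • b'), a' + cc • b'⟫_ℂ‖ ≤ C₁ * X := by
    intro cc hcc
    have e : a' + cc • b' = (a + cc • b) - B.proj (a + cc • b) := (B.sub_proj_add_smul a b cc).symm
    rw [e]
    exact norm_inner_kernelCLM_self_le hΓ hneg hd hF hvol hinfty hper hineq hcomplete B hk hkc hH hHh hI w₀ z₀ hδ hδ1 hδ' hδ'1 hcc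
  have hpol := inner_map_polarization' (T : L2F →ₗ[ℂ] L2F) a' b'
  simp only [ContinuousLinearMap.coe_coe] at hpol
  rw [hpol]
  have h1 : ‖⟪T (a' + b'), a' + b'⟫_ℂ‖ ≤ C₁ * X := by simpa using hQ 1 (by simp)
  have h2 : ‖⟪T (a' - b'), a' - b'⟫_ℂ‖ ≤ C₁ * X := by simpa [sub_eq_add_neg] using hQ (-1) (by simp)
  have h3 : ‖⟪T (a' + Complex.I • b'), a' + Complex.I • b'⟫_ℂ‖ ≤ C₁ * X := hQ Complex.I (by simp)
  have h4 : ‖⟪T (a' - Complex.I • b'), a' - Complex.I • b'⟫_ℂ‖ ≤ C₁ * X := by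
    simpa [sub_eq_add_neg] using hQ (-Complex.I) (by simp)
  rw [norm_div, Complex.norm_ofNat]
  have hnum : ‖⟪T (a' + b'), a' + b'⟫_ℂ - ⟪T (a' - b'), a' - b'⟫_ℂ -
      Complex.I * ⟪T (a' + Complex.I • b'), a' + Complex.I • b'⟫_ℂ +
      Complex.I * ⟪T (a' - Complex.I • b'), a' - Complex.I • b'⟫_ℂ‖ ≤ 4 * (C₁ * X) := by
    refine (norm_add_le _ _).trans ?_
    have e1 : ‖⟪T (a' + b'), a' + b'⟫_ℂ - ⟪T (a' - b'), a' - b'⟫_ℂ - Complex.I * ⟪T (a' + Complex.I • b'), a' + Complex.I • b'⟫_ℂ‖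
        ≤ C₁ * X + C₁ * X + C₁ * X := by
      refine (norm_sub_le _ _).trans (add_le_add ((norm_sub_le _ _).trans (add_le_add h1 h2)) ?_)
      rw [norm_mul, Complex.norm_I, one_mul]; exact h3
    have e2 : ‖Complex.I * ⟪T (a' - Complex.I • b'), a' - Complex.I • b'⟫_ℂ‖ ≤ C₁ * X := by
      rw [norm_mul, Complex.norm_I, one_mul]; exact h4
    linarith
  calc ‖⟪T (a' + b'), a' + b'⟫_ℂ - ⟪T (a' - b'), a' - b'⟫_ℂ -
        Complex.I * ⟪T (a' + Complex.I • b'), a' + Complex.I • b'⟫_ℂ +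
        Complex.I * ⟪T (a' - Complex.I • b'), a' - Complex.I • b'⟫_ℂ‖ / 4 ≤ 4 * (C₁ * X) / 4 := by gcongr
    _ = C₁ * X := by ring

end FormBound

end Fuchsian

/-! ## 7. The limits and the discharges of `Iwaniec2002_eq_12_5` and `Iwaniec2002_thm_12_1` -/

section Final

/-- **Iwaniec (12.5), proved** (`Iwaniec2002_eq_12_5_holds`): the pretrace estimate for a finite
volume group, with the constant `C = 2 C₁(z, w)` of `Fuchsian.formConst`. The proof: for the
approximate identities `a = G_w^δ`, `b = G_z^{δ'}` and their projections `a', b'` away from the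
small eigenfunctions, `|⟨b', T_k a'⟩| ≤ C₁ (H(0) + ∫(t+1)H)` (`Fuchsian.norm_inner_kernelCLM_proj_le`),
while `⟨b', T_k a'⟩ = ⟨b, T_k a⟩ - Σ_j ⟨e_j, a⟩ h(t_j) ⟨b, e_j⟩ → ½ K(z, w) - Σ_j ū_j(w) h(t_j) u_j(z)`
as `δ → 0` then `δ' → 0` (`BallVector`). [cite: Iwaniec2002, (12.5), PDF pp. 125–126] -/
theorem Iwaniec2002_eq_12_5_holds : Iwaniec2002_eq_12_5 := by
  intro Γ F hΓ hneg hd hF hvol B z w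
  obtain ⟨h, 𝔞, σ, _, hinfty, hper, hineq, hcomplete⟩ := Fuchsian.exists_cuspSystem hΓ hneg hd hF hvol
  refine ⟨2 * Fuchsian.formConst hΓ hd B w z, fun k hkc hk _ H hH hHh hI => ?_⟩
  set X : ℝ := H 0 + ∫ t in Ioi 0, (t + 1) * H t with hX
  set C₁ : ℝ := Fuchsian.formConst hΓ hd B w z with hC₁
  set T := kernelCLM hΓ hneg hd hF hk hkc with hT
  set tj : Fin B.n → ℂ := fun j => Complex.I * ((B.s j - 1 / 2 : ℝ) : ℂ) with htj
  -- the automorphic kernel `K(·, w)` in `L²(F)`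
  have hKmem := memLp_automorphicKernel hΓ hneg hd hF hk hkc w
  set Kw : Lp ℂ 2 ((volume : Measure ℍ).restrict F) := hKmem.toLp _ with hKw
  -- the limit value
  set L : ℂ := (1 / 2 : ℂ) * (automorphicKernel Γ k z w : ℂ) -
    ∑ j, conj (B.u j w) * selbergTransform k (tj j) * B.u j z with hL
  -- the quantity `E(δ, δ')`
  set E : ℝ → ℝ → ℂ := fun δ δ' =>
    ⟪ballVec hΓ hneg hd hF δ' z - B.proj (ballVec hΓ hneg hd hF δ' z),
      T (ballVec hΓ hneg hd hF δ w - B.proj (ballVec hΓ hneg hd hF δ w))⟫_ℂ with hE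
  have hE_eq : ∀ δ δ', E δ δ' = ⟪ballVec hΓ hneg hd hF δ' z, T (ballVec hΓ hneg hd hF δ w)⟫_ℂ -
      ∑ j, ⟪B.vec j, ballVec hΓ hneg hd hF δ w⟫_ℂ * selbergTransform k (tj j) * ⟪ballVec hΓ hneg hd hF δ' z, B.vec j⟫_ℂ :=
    fun δ δ' => B.inner_sub_proj_kernelCLM_sub_proj hΓ hneg hd hF hk hkc _ _
  -- the bound on `E`
  have hE_bound : ∀ δ δ', 0 < δ → δ ≤ 1 / 256 → 0 < δ' → δ' ≤ 1 / 256 → ‖E δ δ'‖ ≤ C₁ * X := by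
    intro δ δ' hδ hδ1 hδ' hδ'1
    rw [hE]
    simp only
    rw [← inner_conj_symm, Complex.norm_conj]
    exact Fuchsian.norm_inner_kernelCLM_proj_le hΓ hneg hd hF hvol hinfty hper hineq hcomplete B hk hkc hH hHh hI w z
      hδ hδ1 hδ' hδ'1
  have hsmall : ∀ᶠ δ : ℝ in 𝓝[>] 0, 0 < δ ∧ δ ≤ 1 / 256 := by
    filter_upwards [self_mem_nhdsWithin, nhdsWithin_le_nhds (Iic_mem_nhds (by norm_num : (0 : ℝ) < 1 / 256))] with δ hδ hδ1
    exact ⟨hδ, hδ1⟩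
  -- first limit `δ → 0⁺`
  set E₁ : ℝ → ℂ := fun δ' => ⟪ballVec hΓ hneg hd hF δ' z, (1 / 2 : ℂ) • Kw⟫_ℂ -
    ∑ j, conj (B.u j w) * selbergTransform k (tj j) * ⟪ballVec hΓ hneg hd hF δ' z, B.vec j⟫_ℂ with hE₁
  have hlim1 : ∀ δ', Tendsto (fun δ => E δ δ') (𝓝[>] 0) (𝓝 (E₁ δ')) := by
    intro δ'
    simp only [hE_eq, hE₁]
    refine Tendsto.sub ?_ ?_
    · exact Filter.Tendsto.inner tendsto_const_nhds (tendsto_kernelCLM_ballVec hΓ hneg hd hF hk hkc w)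
    · refine tendsto_finsetSum _ fun j _ => ?_
      have h1 : Tendsto (fun δ => ⟪B.vec j, ballVec hΓ hneg hd hF δ w⟫_ℂ) (𝓝[>] 0) (𝓝 (conj (B.u j w))) :=
        tendsto_inner_toLp_ballVec hΓ hneg hd hF (B.isAutomorphic j) (B.isC2 j) (B.eigen j) (B.quarter_add_sq j) (B.memLp j) w
      exact (h1.mul_const _).mul_const _
  have hE₁_bound : ∀ δ', 0 < δ' → δ' ≤ 1 / 256 → ‖E₁ δ'‖ ≤ C₁ * X := by
    intro δ' hδ' hδ'1
    refine le_of_tendsto ((hlim1 δ').norm) ?_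
    filter_upwards [hsmall] with δ hδ
    exact hE_bound δ δ' hδ.1 hδ.2 hδ' hδ'1
  -- second limit `δ' → 0⁺`
  have hKa : IsAutomorphic Γ fun v => (automorphicKernel Γ k v w : ℂ) := by
    obtain ⟨_, _, ⟨M, _, hM⟩⟩ := id hk
    intro γ hγ v
    simp only
    rw [automorphicKernel_smul_left hΓ hd hM hγ]
  have hKc : Continuous fun v => (automorphicKernel Γ k v w : ℂ) :=
    Complex.continuous_ofReal.comp (continuous_automorphicKernel_left hΓ hd hk hkc w)
  have hlim2 : Tendsto E₁ (𝓝[>] 0) (𝓝 L) := by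
    simp only [hE₁, hL]
    refine Tendsto.sub ?_ ?_
    · have h1 := tendsto_inner_ballVec_toLp hΓ hneg hd hF hKa hKc hKmem z
      have h2 : ∀ δ', ⟪ballVec hΓ hneg hd hF δ' z, (1 / 2 : ℂ) • Kw⟫_ℂ = (1 / 2 : ℂ) * ⟪ballVec hΓ hneg hd hF δ' z, Kw⟫_ℂ :=
        fun δ' => inner_smul_right _ _ _
      simp_rw [h2]
      exact h1.const_mul _
    · refine tendsto_finsetSum _ fun j _ => ?_
      have h1 : Tendsto (fun δ' => ⟪B.vec j, ballVec hΓ hneg hd hF δ' z⟫_ℂ) (𝓝[>] 0) (𝓝 (conj (B.u j z))) :=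
        tendsto_inner_toLp_ballVec hΓ hneg hd hF (B.isAutomorphic j) (B.isC2 j) (B.eigen j) (B.quarter_add_sq j) (B.memLp j) z
      have h2 : Tendsto (fun δ' => ⟪ballVec hΓ hneg hd hF δ' z, B.vec j⟫_ℂ) (𝓝[>] 0) (𝓝 (B.u j z)) := by
        have h3 := (Complex.continuous_conj.tendsto _).comp h1
        rw [Complex.conj_conj] at h3
        refine h3.congr fun δ' => ?_
        simp only [Function.comp_apply, inner_conj_symm]
      exact h2.const_mul _
  have hL_bound : ‖L‖ ≤ C₁ * X := by
    refine le_of_tendsto (hlim2.norm) ?_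
    filter_upwards [hsmall] with δ' hδ'
    exact hE₁_bound δ' hδ'.1 hδ'.2
  -- conclusion
  have e : (automorphicKernel Γ k z w : ℂ) - 2 * ∑ j, selbergTransform k (tj j) * B.u j z * conj (B.u j w) = 2 * L := by
    rw [hL, mul_sub, Finset.mul_sum, Finset.mul_sum]
    congr 1
    · ring
    · exact Finset.sum_congr rfl fun j _ => by ring
  rw [e, norm_mul, Complex.norm_ofNat]
  linarith


/-- **Iwaniec, Theorem 12.1, proved** (`Iwaniec2002_thm_12_1_holds`): the discharge of the named fact
`Iwaniec2002_thm_12_1` of `HyperbolicLaplaceSpectrum.lean` —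
`P(X) = Σ_{1/2 < s_j ≤ 1} 2π^{1/2} Γ(s_j - 1/2)/Γ(s_j + 1) u_j(z) ū_j(w) X^{s_j} + O(X^{2/3})` for every
finite volume group. It is (12.5) ⇒ Theorem 12.1 (`Iwaniec2002_thm_12_1_of_eq_12_5`,
`ModularLatticeCount.lean`: the kernel of Fig. 11, (12.7)–(12.9), `Y = X^{2/3}`) applied to
`Iwaniec2002_eq_12_5_holds`. [cite: Iwaniec2002, Thm 12.1, (12.5)–(12.9), PDF pp. 125–126] -/
theorem Iwaniec2002_thm_12_1_holds : Iwaniec2002_thm_12_1 :=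
  Iwaniec2002_thm_12_1_of_eq_12_5 Iwaniec2002_eq_12_5_holds

end Final

end Literature.NumberTheory.Automorphic

end
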